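import Literature.NumberTheory.Automorphic.GaloisActionAdeleRing
import Literature.NumberTheory.Automorphic.AutomorphicRepsGL
import HarnessLib

/-!
# Unitary groups of a quadratic extension `E/F`, their automorphic representations, and
# unramified base change to `GL_N(E_w)` on Satake parameters

Topic `NumberTheory/Automorphic`; namespace `Literature.NumberTheory.Automorphic` (grouping
sub-namespaces `UnitaryGroup`, `StdForm`). Definition request `defn-UnitaryGroupAutomorphicRep`
(route `Langlands/QuadraticWindow`, cruxes `HostInducedRep` / `SignLaw`; a TOOL — the summit stays
`GL_n`-only). Everything here is a definition or a proved lemma: **no named facts, no `sorry`**.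

**Setting.** `E/F` an extension of number fields with an automorphism `c : E ≃ₐ[F] E` (the facts
one states with these notions assume `[E : F] = 2`, `c ≠ 1`; the definitions need neither), `N : ℕ`,
and a matrix `J ∈ M_N(E)`. Following Mok (Mem. AMS 1108 = arXiv:1206.0882, §1 *Notation*, p. 5)
the unitary group is `U(J)(F) = {g ∈ GL_N(E) | ᵗc(g) J g = J}`, a subgroup of
`G_{E/F}(N) = Res_{E/F} GL_N`; Mok's quasi-split `U_{E/F}(N)` is `J = J_N = antidiag(1, …, 1)`.

## Contents

* `unitaryGroupOfForm σ J ≤ GL_n(R)` for any commutative ring `R` with a ring endomorphism `σ`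
  (`{g | (σ g)ᵀ J g = J}`), its functoriality `unitaryGroupOfFormMap` along `f` with `f σ = τ f`.
  Instances of `(R, σ)`: `(E, c)`, `(𝔸_E, c ⊗ 1)` (the accepted `instMulSemiringActionAdeleRing`),
  `(E_v := ∏_{w ∣ v} E_w, c ⊗ 1)` (`UnitaryGroup.LocalRing`, `conjLocal`, via the accepted
  `galAdicCompletionMap`), `(E ⊗ ℝ = mixedSpace E, c ⊗ 1)` (`conjMixed`, transport along Mathlib's
  `InfiniteAdeleRing.ringEquiv_mixedSpace`).
* **`UnitaryGroup.adelicGroupData F E c N J : AdelicGroupData F`** — `U(J)` as an instance of the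
  tree's axiomatic adelic datum: `Rational = U(J)(F)`, `Adelic = U(J)(𝔸_F) ≤ GL_N(𝔸_E)`,
  `Local v = U(J)(F_v) ≤ GL_N(∏_{w∣v} E_w)`, and split component `A_G = 1` (`center' = ⊥`: the centre
  `U(1)_{E/F}` is anisotropic, Mok §1), for ANY `J`.
* **Standard forms** `StdForm N` (integer `J₀` with `J₀ᵀ = J₀`, `J₀² = 1`: Mok's `antidiagonal N`,
  `one N`, signature forms), `S.over R`. For these, **`UnitaryGroup.archGroup : RealMatrixGroup
  (mixedSpace E) (Fin N)`** — `U(J₀)(E ⊗ ℝ) = ∏_{v∣∞} U(J₀)(F_v)` as a linear real group with Lie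
  algebra `𝔲(J₀) = {X | ((c⊗1)X)ᵀ J₀ + J₀ X = 0}`, all four axioms PROVED (closed; `exp`-closed via
  `map_conjMixed_exp`; `Ad`-stable; stable under conjugate transpose via `star_conjMixed`: `c ⊗ 1`
  commutes with the involution of `ℝ^{r₁} × ℂ^{r₂}`, each complex coordinate map being a continuous
  ring endomorphism of `ℂ`, hence `id` or `conj`), and **`UnitaryGroup.automorphyDatum F E c N S hcpt :
  AutomorphyDatum (adelicGroupData … (S.over E)) (mixedSpace E) (Fin N)`** (Borel–Jacquet §4.1 for
  `G = U(J₀)`: `ofArch g = (g, 1)` with `ofInfinite_mem_adelic`, finite-adelic points, levels = traces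
  of compact open subgroups of `GL_N(𝔸_E^∞)`, height = restriction of `adelicHeightGL`; the
  compactness of `GL_N(𝒪̂_E)` is the parameter `hcpt`, exactly as for `AutomorphyDatum.gl`).
  Hence the accepted `AutomorphicRepData`, `IsAutomorphicForm`, `π.kRep`, `π.finiteRep`,
  `π.HasLieAction`, `π.HasInfinitesimalCharacter` apply verbatim to unitary groups.
* **Mok's group**: `quasiSplit`, `quasiSplitDatum`; cusp forms (`unipotentRadical k` = `U ∩ N_k(𝔸_E)`
  for the maximal parabolic stabilising the isotropic flag `⟨e_1,…,e_k⟩`, `1 ≤ k ≤ N/2`;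
  `CuspCondition` with the Haar measure of the (non-abelian) group `N_k(𝔸_F)` and a fundamental
  domain for `N_k(F)`; `IsCuspForm`, `cuspForms`, `CuspidalAutomorphicRepData`), and the wanted
  type `UnitaryGroupAutomorphicRep F E c N hcpt`.
* **Archimedean parameters** at a complex place `w` of `E` fixed by `c ≠ 1` (a real place `v` of `F`
  with `U(J₀)(F_v) ≅ U(p,q)`): `c ⊗ 1` acts on the `w`-factor `𝔤𝔩_N(ℂ) ⊆ 𝔤𝔩_N(E ⊗ ℝ)` by complex
  conjugation (`conjCoord_eq_conj`, `map_conjMixed_complexPlaceLie`), `𝔲_w = {M | M̄ᵀ J₀ + J₀ M = 0}`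
  (`complexPlaceLie_mem_archLie_iff`) is a real form of `𝔤𝔩_N(ℂ) = 𝔲_w ⊕ i 𝔲_w` (`archRealPart`,
  `archImagPart`), and the complexified action restricted to `𝔤𝔩_N(ℝ)`,
  **`complexifyAt … ρ𝔤 : 𝔤𝔩_N(ℝ) →ₗ⁅ℝ⁆ End_ℂ V`** (a PROVED Lie algebra homomorphism,
  `Z ↦ ½(ρ𝔤 A(Z) + i ρ𝔤 B(Z))`), whose Harish-Chandra parameter in the accepted sense
  (`HasHCParameter` for `𝔤𝔩_N(ℝ)`) is the infinitesimal character of `π_v`: `HasHCParameterAt π hw hc Λ`.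
* **Unramified base change on Satake parameters** (`HasBaseChangeSatakeAt π w α`, `IsUnramifiedAt`,
  `IsWeakBaseChange Π π`): at a finite place `w` of `E` over `v`, with the hyperspecial level
  `level 𝔫 = U ∩ K(𝔫)` (`w, c w ∤ 𝔫`), `π` has a spherical vector on which every Hecke operator
  `[K t K]` (`t` supported over `v`; accepted `heckeOperator`) acts by the UNRAMIFIED EIGENVALUE
  `heckeEigenvalue w β K t = ∑_{y ∈ KtK/K} (χ_β δ_B^{1/2})(b_y)` — the Satake transform written as the
  Iwasawa sum (Cartier, Corvallis 1979, §3.3 and (4.2)), which needs no closed formula — and `α` is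
  the multiset of the torus parameters `β`, subject to the base-change constraint
  `IsBaseChangeParam` (`β_{N-1-i} = β_i⁻¹`, middle `= 1`, when `c w = w`). This renders the standard
  base change `ξ_1` of Mok §2.1 on unramified classes: at a split `v = w w̄`, `U(F_v) ≅ GL_N(E_w)` and
  `ξ_1` is the identity on parameters; at an inert `v`, `ξ_1(t ⋊ Frob_v) = (t Φ_N, ᵗt⁻¹Φ_N⁻¹) ⋊ Frob_v`
  has `GL_N(E_w)`-Satake class `t · Φ_N t⁻¹ Φ_N⁻¹ = diag(t_i t_{N+1-i}⁻¹)` (Mok §2.1 (2.1.9);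
  Mínguez 2011, Thm. 4.1: `BC(I(χ_1,…,χ_m)) = I(χ_1,…,χ_m,(1),χ_m⁻¹,…,χ_1⁻¹)` for unramified `χ_i`).
  The modulus character of the Borel of `U(J_N)(F_v)` on its diagonal torus is the square root of
  that of `GL_N(E_w)` (the root spaces `(i,j)`, `(N+1-j,N+1-i)` pair up under `c`), so
  `δ_B^{1/2}(b) = ∏_i (√q_w)^{-(N-1-2i) ord_w b_ii}` over the free torus coordinates in both cases.

## Design notes

* Typing rule as in `AutomorphicRepsGL`: forms and group elements are typed on
  `(UnitaryGroup.quasiSplit F E c N).Adelic`; `UnitaryGroup.adelicVal` is the inclusion into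
  `GL_N(𝔸_E)` typed on the datum (the bare coercion does not elaborate through the structure
  projection). `AdelicGroupData` needs its `adTopGroup` field given explicitly (instance search does
  not find `Subgroup.instIsTopologicalGroupSubtypeMem` through the projection).
* (H5) `open scoped Classical` in the archimedean sections: the place subtypes indexing
  `mixedSpace E` are `Fintype` classically (without it `NormedCommRing (mixedSpace E)` is not found).
  (H1) `LieRing.ofAssociativeRing` local instance. (H3) no matrix norm: `map_conjMixed_exp` goes through
  `NormedSpace.exp_eq_tsum_rat` and `Function.LeftInverse.map_tsum` (`c⁻¹ ⊗ 1` is a continuous inverse).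
* Why standard forms only for `G_∞`: the tree's `RealMatrixGroup` demands stability under the conjugate
  transpose of `GL_N(mixedSpace E)` in the given coordinates, which for `U(J)` holds iff `J J*` is
  scalar at every archimedean place; integer symmetric involutions `J₀` (entries fixed by `c ⊗ 1` and
  by `star`) are the uniform sufficient class, covering the quasi-split groups for every quadratic
  `E/F`, the definite groups (`J₀ = 1`, `E/F` CM) and all `U(p,q)`-signature forms. A general
  Hermitian `J` is isometric over `E ⊗ ℝ` to such a form; conjugating into standard position is left
  to the user who needs it (the algebraic/adelic datum `adelicGroupData` is available for every `J`).
* Cuspidality and Satake data are given for Mok's `J_N` only (they use its standard Borel and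
  parabolics: upper triangular matrices meet `U(J_N)` in a Borel subgroup, block-unipotent matrices in
  unipotent radicals). For other forms (e.g. anisotropic `J₀ = 1`, where every automorphic form is
  cuspidal) no cusp condition is defined here.
* Junk values, documented: `diagOrd` is `0` on a zero entry; `iwasawaValue` is `0` on cosets without an
  upper-triangular representative supported over `v` and uses `Exists.choose` otherwise (independent
  of the choice when `K ∩ B`-invariance holds, i.e. `K` hyperspecial at `v`, which `w, c w ∤ 𝔫`
  guarantees for `v` unramified in `E`); `heckeEigenvalue` is a `finsum` (`0` on infinite orbits), as
  the accepted `heckeOperator`; `HasBaseChangeSatakeAt` is meaningful for `v` unramified in `E`.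
* Universe: all data live in `Type` (`AdelicGroupData.{0} F`), like `AdelicGroupData.gl`.

## What is NOT here (follow-ups)

* (Non-degenerate limits of) discrete series themselves — the separate wanted notion
  `IsNondegenerateLimitOfDiscreteSeries`; the host objects it needs (`π.kRep`, `π.HasLieAction` on
  `𝔲(J₀)(E ⊗ ℝ) = (automorphyDatum …).arch.lie`, `complexifyAt`, `HasHCParameterAt`) are here. Real
  places of `F` that split in `E` (where `U(F_v) ≅ GL_N(ℝ)`) and complex places of `F` are not given a
  place-by-place parameter here (the CM-over-totally-real case needs only the inert real places).
* Unitary similitude groups `GU` / unitary Kottwitz data `(B = E, *, V, ⟨,⟩, h)` (Shimura data are out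
  of scope; `GU` would have `A_G = ℝ_{>0}`).
* The named facts these notions are for (Mok 2014, Thm. 2.5.2 / Cor. 4.3.8: weak base change and
  descent for `U_{E/F}(N)`; Labesse, Clozel–Harris–Labesse; Goldring–Koskivirta Thm. 3.5.5) — cite
  items of the planner; `IsWeakBaseChange` + `AsaiSign.HasAsaiSign` + `CuspidalAutomorphicRepData`
  are the interface.
* `U(J)(F)` discrete in `U(J)(𝔸_F)`, finite volume / compactness criteria, the comparison
  `Local v ≅ GL_N(F_v)` at split `v`, hyperspeciality of `U ∩ GL_N(𝒪_{E_w})` — theorems, not needed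
  by the definitions.

## References

* C. P. Mok, *Endoscopic classification of representations of quasi-split unitary groups*, Mem.
  Amer. Math. Soc. 235 (2015), no. 1108 (arXiv:1206.0882): §1 Notation (p. 5), §2.1 (L-groups,
  `ξ_{χ_κ}`), §2.3–2.5 (Thm. 2.4.2, 2.5.2, 2.5.4), §4.3 (weak base change, Cor. 4.3.8). [Mok2014]
* A. Mínguez, *Unramified representations of unitary groups*, in: On the stabilization of the trace
  formula (Stab. Trace Formula Shimura Var. Arith. Appl. 1), Int. Press 2011, 389–410, Thm. 4.1.
  [Minguez2011]
* P. Cartier, *Representations of p-adic groups: a survey*, Proc. Sympos. Pure Math. 33 (Corvallis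
  1979), part 1, §3.2–3.3, §IV (4.2) (Satake transform via the Iwasawa decomposition). [CartierCorvallis1979]
* A. Borel, H. Jacquet, *Automorphic forms and automorphic representations*, Corvallis 1979, part 1,
  §4.1–4.6. [BorelJacquet1979]
* J. W. S. Cassels, A. Fröhlich (eds.), *Algebraic Number Theory* (1967), Ch. II §10–§14, Ch. VII §1.1.
  [CasselsFrohlichANT1967]
* A. W. Knapp, *Lie Groups Beyond an Introduction*, 2nd ed. (2002), I.§1, VII.§2 Example 2. [Knapp2002]
-/

noncomputable section

open scoped MatrixGroups Matrix
open NumberField IsDedekindDomain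

namespace Literature.NumberTheory.Automorphic

/-! ## The unitary group of a form over a ring with an endomorphism -/

section UnitaryGroupOfForm

variable {R S : Type*} [CommRing R] [CommRing S] {n : Type*} [Fintype n] [DecidableEq n]

/-- The **unitary group of the form `J` with respect to the ring endomorphism `σ`**:
`U(σ, J)(R) = {g ∈ GL_n(R) | (σ g)ᵀ · J · g = J}`, where `σ g` is `σ` applied entrywise. For
`R = E` a quadratic extension of `F` with conjugation `σ = c` and `J` Hermitian (`(c J)ᵀ = J`)
this is the group of `F`-points of the unitary group of the Hermitian form `h(x, y) = (c x)ᵀ J y`;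
base-changed rings `R = E ⊗_F R₀` with `σ = c ⊗ 1` give its `R₀`-points (Mok 2014, §1 Notation,
p. 5: `U_{E/F}(N)(F) = {g ∈ GL_N(E) | ᵗc(g) J g = J}`). No condition on `σ` or `J` is needed
to have a subgroup. [cite: Mok2014, §1 Notation p. 5] -/
def unitaryGroupOfForm (σ : R →+* R) (J : Matrix n n R) : Subgroup (GL n R) where
  carrier := {g | ((g : Matrix n n R).map σ)ᵀ * J * (g : Matrix n n R) = J}
  one_mem' := by
    simp [Matrix.map_one σ (map_zero σ) (map_one σ)]
  mul_mem' {g h} hg hh := by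
    simp only [Set.mem_setOf_eq, Units.val_mul, Matrix.map_mul, Matrix.transpose_mul] at hg hh ⊢
    calc ((h : Matrix n n R).map σ)ᵀ * ((g : Matrix n n R).map σ)ᵀ * J * ((g : Matrix n n R) * h)
        = ((h : Matrix n n R).map σ)ᵀ * ((((g : Matrix n n R).map σ)ᵀ * J * g)) * h := by
          simp only [Matrix.mul_assoc]
      _ = J := by rw [hg, hh]
  inv_mem' {g} hg := by
    simp only [Set.mem_setOf_eq] at hg ⊢
    have h1 : (((g⁻¹ : GL n R) : Matrix n n R).map σ)ᵀ * ((g : Matrix n n R).map σ)ᵀ = 1 := by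
      rw [← Matrix.transpose_mul, ← Matrix.map_mul, ← Units.val_mul, mul_inv_cancel, Units.val_one,
        Matrix.map_one σ (map_zero σ) (map_one σ), Matrix.transpose_one]
    calc (((g⁻¹ : GL n R) : Matrix n n R).map σ)ᵀ * J * ((g⁻¹ : GL n R) : Matrix n n R)
        = (((g⁻¹ : GL n R) : Matrix n n R).map σ)ᵀ * (((g : Matrix n n R).map σ)ᵀ * J * g) *
            ((g⁻¹ : GL n R) : Matrix n n R) := by rw [hg]
      _ = ((((g⁻¹ : GL n R) : Matrix n n R).map σ)ᵀ * ((g : Matrix n n R).map σ)ᵀ) * J *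
            ((g : Matrix n n R) * ((g⁻¹ : GL n R) : Matrix n n R)) := by
          simp only [Matrix.mul_assoc]
      _ = J := by rw [h1, ← Units.val_mul, mul_inv_cancel, Units.val_one, Matrix.one_mul,
            Matrix.mul_one]

/-- Membership in `U(σ, J)(R)`: `(σ g)ᵀ J g = J` (definitional). [cite: Mok2014, §1 Notation p. 5] -/
theorem mem_unitaryGroupOfForm_iff {σ : R →+* R} {J : Matrix n n R} {g : GL n R} :
    g ∈ unitaryGroupOfForm σ J ↔ ((g : Matrix n n R).map σ)ᵀ * J * (g : Matrix n n R) = J :=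
  Iff.rfl

/-- **Non-vacuity**: a scalar `u` of `σ`-norm one (`σ(u) u = 1`) lies in `U(σ, J)(R)` for every `J`
(for `E/F` quadratic these are the norm-one elements `E¹ = U(1)_{E/F}`, the centre of `U(J)`;
Mok 2014, §1: "we identify the centre of `U_{E/F}(N)` as `U_{E/F}(1)`"). [cite: Mok2014, §1 Notation p. 5] -/
theorem scalar_mem_unitaryGroupOfForm (σ : R →+* R) (J : Matrix n n R) (u : Rˣ)
    (hu : σ (u : R) * u = 1) :
    Units.map (Matrix.scalar n : R →+* Matrix n n R).toMonoidHom u ∈ unitaryGroupOfForm σ J := by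
  rw [mem_unitaryGroupOfForm_iff]
  have hcoe : ((Units.map (Matrix.scalar n : R →+* Matrix n n R).toMonoidHom u : GL n R) : Matrix n n R) =
      (u : R) • (1 : Matrix n n R) := by
    simp [Matrix.scalar_apply, Matrix.smul_one_eq_diagonal]
  have hmap : ((u : R) • (1 : Matrix n n R)).map σ = σ u • (1 : Matrix n n R) := by
    ext i j
    simp [Matrix.one_apply, apply_ite σ]
  rw [hcoe, hmap, Matrix.transpose_smul,
    Matrix.transpose_one, Matrix.smul_mul, Matrix.one_mul, Matrix.mul_smul, Matrix.mul_one, smul_smul,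
    mul_comm, hu, one_smul]

/-- **Functoriality of `U(σ, J)`**: a ring homomorphism `f : R → S` intertwining the
endomorphisms (`f ∘ σ = τ ∘ f`) maps `U(σ, J)(R)` into `U(τ, f J)(S)` (apply `f` entrywise to
the defining equation). This is how `U(F) → U(𝔸_F) → U(F_v)` arise below. [folklore] -/
theorem map_mem_unitaryGroupOfForm {σ : R →+* R} {τ : S →+* S} (f : R →+* S)
    (hf : ∀ x, f (σ x) = τ (f x)) {J : Matrix n n R} {g : GL n R}
    (hg : g ∈ unitaryGroupOfForm σ J) :
    Matrix.GeneralLinearGroup.map f g ∈ unitaryGroupOfForm τ (J.map f) := by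
  rw [mem_unitaryGroupOfForm_iff] at hg ⊢
  have hfg : ((Matrix.GeneralLinearGroup.map f g : GL n S) : Matrix n n S) =
      (g : Matrix n n R).map f := rfl
  have key := congrArg (fun M : Matrix n n R => M.map f) hg
  simp only [Matrix.map_mul, Matrix.transpose_map, Matrix.map_map] at key
  rw [hfg, Matrix.map_map]
  have hcomp : (τ ∘ f : R → S) = (f ∘ σ : R → S) := funext fun x => (hf x).symm
  rw [hcomp]
  simpa [Matrix.transpose_map] using key

/-- The homomorphism `U(σ, J)(R) →* U(τ, f J)(S)` induced by `f : R →+* S` with `f ∘ σ = τ ∘ f`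
(restriction of `GL_n(f)`). [folklore] -/
def unitaryGroupOfFormMap {σ : R →+* R} {τ : S →+* S} (f : R →+* S)
    (hf : ∀ x, f (σ x) = τ (f x)) (J : Matrix n n R) :
    unitaryGroupOfForm σ J →* unitaryGroupOfForm τ (J.map f) :=
  ((Matrix.GeneralLinearGroup.map f).restrict (unitaryGroupOfForm σ J)).codRestrict _
    fun g => map_mem_unitaryGroupOfForm f hf g.2

/-- `unitaryGroupOfFormMap f hf J g = GL_n(f) g` on underlying invertible matrices. [folklore] -/
@[simp] theorem coe_unitaryGroupOfFormMap {σ : R →+* R} {τ : S →+* S} (f : R →+* S)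
    (hf : ∀ x, f (σ x) = τ (f x)) (J : Matrix n n R) (g : unitaryGroupOfForm σ J) :
    (unitaryGroupOfFormMap f hf J g : GL n S) = Matrix.GeneralLinearGroup.map f g := rfl

/-- `unitaryGroupOfFormMap` is continuous for the unit-group topologies when `f` is. [folklore] -/
theorem continuous_unitaryGroupOfFormMap [TopologicalSpace R] [IsTopologicalRing R]
    [TopologicalSpace S] [IsTopologicalRing S] {σ : R →+* R} {τ : S →+* S} (f : R →+* S)
    (hf : ∀ x, f (σ x) = τ (f x)) (J : Matrix n n R) (hc : Continuous f) :
    Continuous (unitaryGroupOfFormMap f hf J) :=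
  Continuous.subtype_mk (hc.generalLinearGroup_map.comp continuous_subtype_val) _

end UnitaryGroupOfForm

/-! ## The unitary group of a Hermitian matrix over a quadratic extension of number fields -/

namespace UnitaryGroup

variable (F E : Type) [Field F] [NumberField F] [Field E] [NumberField E] [Algebra F E]
variable (c : E ≃ₐ[F] E) (N : ℕ) (J : Matrix (Fin N) (Fin N) E)

/-- The conjugation `c ⊗ 1` of `𝔸_E = E ⊗_F 𝔸_F` as a ring endomorphism of `AdeleRing (𝓞 E) E`
(the accepted action `instMulSemiringActionAdeleRing` of `GaloisActionAdeleRing`, Cassels–Fröhlich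
VII §1.1, packaged by Mathlib's `MulSemiringAction.toRingHom`). [cite: CasselsFrohlichANT1967, Ch. VII §1.1] -/
def conjAdele : AdeleRing (𝓞 E) E →+* AdeleRing (𝓞 E) E :=
  MulSemiringAction.toRingHom (E ≃ₐ[F] E) _ c

omit [NumberField F] in
/-- `conjAdele c x = c • x` (definitional). [folklore] -/
@[simp] theorem conjAdele_apply (x : AdeleRing (𝓞 E) E) : conjAdele F E c x = c • x := rfl

omit [NumberField F] in
/-- The diagonal embedding `E → 𝔸_E` intertwines `c` with `c ⊗ 1`
(`AdeleRing.smul_algebraMap`). [folklore] -/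
theorem algebraMap_conj (x : E) :
    algebraMap E (AdeleRing (𝓞 E) E) ((c : E →+* E) x) = conjAdele F E c (algebraMap E _ x) := by
  rw [conjAdele_apply, AdeleRing.smul_algebraMap]
  rfl

/-- The group of rational points `U(J)(F) = {g ∈ GL_N(E) | (c g)ᵀ J g = J}` (Mok 2014, §1,
p. 5, for Mok's `J`; here `J` is any matrix). [cite: Mok2014, §1 Notation p. 5] -/
def rational : Subgroup (GL (Fin N) E) := unitaryGroupOfForm (c : E →+* E) J

/-- The matrix `J` viewed over the adeles `𝔸_E`. [folklore] -/
def adelicForm : Matrix (Fin N) (Fin N) (AdeleRing (𝓞 E) E) := J.map (algebraMap E _)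

/-- The group of adelic points `U(J)(𝔸_F) = {g ∈ GL_N(𝔸_E) | ((c ⊗ 1) g)ᵀ J g = J}`, a subgroup
of `GL_N(𝔸_E) = (Res_{E/F} GL_N)(𝔸_F)` (Mok 2014, §1: `U_{E/F}(N) ⊂ G_{E/F}(N) = Res_{E/F} GL_N`). [cite: Mok2014, §1 Notation p. 5] -/
def adelic : Subgroup (GL (Fin N) (AdeleRing (𝓞 E) E)) :=
  unitaryGroupOfForm (conjAdele F E c) (adelicForm E N J)

/-- The diagonal embedding `U(J)(F) →* U(J)(𝔸_F)` (restriction of `GL_N(E) → GL_N(𝔸_E)`). [folklore] -/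
def toAdelic : rational F E c N J →* adelic F E c N J :=
  unitaryGroupOfFormMap (algebraMap E (AdeleRing (𝓞 E) E)) (algebraMap_conj F E c) J

/-! ### Local groups `U(J)(F_v)` at the finite places of `F` -/

variable {F} in
/-- The finite places of `E` above a finite place `v` of `F`. [folklore] -/
abbrev PlacesOver (v : HeightOneSpectrum (𝓞 F)) : Type :=
  {w : HeightOneSpectrum (𝓞 E) // w.under (𝓞 F) = v}

variable {F E} in
/-- `c⁻¹ • w` lies over `v` when `w` does (`HeightOneSpectrum.under_algEquiv_smul`). [folklore] -/
theorem under_inv_smul_eq {v : HeightOneSpectrum (𝓞 F)} (w : PlacesOver E v) :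
    (c⁻¹ • w.1).under (𝓞 F) = v := by
  rw [HeightOneSpectrum.under_algEquiv_smul]; exact w.2

variable {F} in
/-- `E_v := E ⊗_F F_v = ∏_{w ∣ v} E_w`, realised as the product of the completions of `E` at the
places above `v` (Cassels–Fröhlich II §10–11: `L ⊗_K K_v = ∏_{w ∣ v} L_w`). [cite: CasselsFrohlichANT1967, Ch. II §10–§11] -/
abbrev LocalRing (v : HeightOneSpectrum (𝓞 F)) : Type :=
  (w : PlacesOver E v) → w.1.adicCompletion E

variable {F} in
/-- The conjugation `c ⊗ 1` of `E_v = ∏_{w ∣ v} E_w`: `(c x)_w = c_w (x_{c⁻¹ w})`, transport along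
the accepted `galAdicCompletionMap` (Cassels–Fröhlich VII §1.1). [cite: CasselsFrohlichANT1967, Ch. VII §1.1] -/
def conjLocal (v : HeightOneSpectrum (𝓞 F)) : LocalRing E v →+* LocalRing E v where
  toFun x w := galAdicCompletionMap c (smul_inv_smul c w.1) (x ⟨c⁻¹ • w.1, under_inv_smul_eq c w⟩)
  map_one' := funext fun w => map_one (galAdicCompletionMap c (smul_inv_smul c w.1))
  map_mul' _ _ := funext fun w => map_mul (galAdicCompletionMap c (smul_inv_smul c w.1)) _ _
  map_zero' := funext fun w => map_zero (galAdicCompletionMap c (smul_inv_smul c w.1))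
  map_add' _ _ := funext fun w => map_add (galAdicCompletionMap c (smul_inv_smul c w.1)) _ _

variable {F} in
/-- Components of `conjLocal` (definitional). [folklore] -/
@[simp] theorem conjLocal_apply (v : HeightOneSpectrum (𝓞 F)) (x : LocalRing E v) (w : PlacesOver E v) :
    conjLocal E c v x w =
      galAdicCompletionMap c (smul_inv_smul c w.1) (x ⟨c⁻¹ • w.1, under_inv_smul_eq c w⟩) := rfl

variable {F} in
/-- The projection `𝔸_E →+* E_v = ∏_{w ∣ v} E_w` onto the components above `v`. [folklore] -/
def adeleToLocal (v : HeightOneSpectrum (𝓞 F)) : AdeleRing (𝓞 E) E →+* LocalRing E v :=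
  RingHom.pi fun w : PlacesOver E v => AdelicGroupData.adeleEval E w.1

variable {F} in
omit [NumberField F] in
/-- Components of `adeleToLocal` (definitional). [folklore] -/
@[simp] theorem adeleToLocal_apply (v : HeightOneSpectrum (𝓞 F)) (x : AdeleRing (𝓞 E) E)
    (w : PlacesOver E v) : adeleToLocal E v x w = x.2 w.1 := rfl

variable {F} in
omit [NumberField F] in
/-- `𝔸_E → E_v` is continuous. [folklore] -/
theorem continuous_adeleToLocal (v : HeightOneSpectrum (𝓞 F)) : Continuous (adeleToLocal E v) :=
  continuous_pi fun w => AdelicGroupData.continuous_adeleEval E w.1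

variable {F} in
/-- `𝔸_E → E_v` intertwines the conjugations (`FiniteAdeleRing.smul_apply`). [folklore] -/
theorem adeleToLocal_conj (v : HeightOneSpectrum (𝓞 F)) (x : AdeleRing (𝓞 E) E) :
    adeleToLocal E v (conjAdele F E c x) = conjLocal E c v (adeleToLocal E v x) := by
  funext w
  rfl

variable {F} in
/-- The group of local points `U(J)(F_v) = {g ∈ GL_N(E_v) | ((c ⊗ 1) g)ᵀ J g = J}`,
`E_v = ∏_{w ∣ v} E_w`; for `v` inert this is a genuine unitary group in `GL_N(E_w)`, for `v`
split it projects isomorphically onto either factor `GL_N(E_w) = GL_N(F_v)` (Mok 2014, §1,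
p. 5). [cite: Mok2014, §1 Notation p. 5] -/
def «local» (v : HeightOneSpectrum (𝓞 F)) : Subgroup (GL (Fin N) (LocalRing E v)) :=
  unitaryGroupOfForm (conjLocal E c v) ((adelicForm E N J).map (adeleToLocal E v))

variable {F} in
/-- The projection `U(J)(𝔸_F) →* U(J)(F_v)`. [folklore] -/
def toLocal (v : HeightOneSpectrum (𝓞 F)) : adelic F E c N J →* «local» E c N J v :=
  unitaryGroupOfFormMap (adeleToLocal E v) (adeleToLocal_conj E c v) (adelicForm E N J)

/-- **The unitary group `U(J)` of `E/F` as an adelic group datum over `F`**: rational points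
`U(J)(F) ≤ GL_N(E)`, adelic points `U(J)(𝔸_F) ≤ GL_N(𝔸_E)`, local points
`U(J)(F_v) ≤ GL_N(∏_{w∣v} E_w)`, and TRIVIAL split component `A_G = 1`: the centre of `U(J)` is
`U(1)_{E/F}` (Mok 2014, §1), an anisotropic torus, so the automorphic quotient is
`U(J)(F) \ U(J)(𝔸_F)` itself (finite volume; compact iff `J` is anisotropic). Stated for any
`c`, `J`; meaningful for `[E : F] = 2`, `c ≠ 1`, `J` invertible Hermitian. [cite: Mok2014, §1 Notation p. 5] -/
def adelicGroupData : AdelicGroupData.{0} F where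
  Rational := rational F E c N J
  Adelic := adelic F E c N J
  adTopGroup := Subgroup.instIsTopologicalGroupSubtypeMem _
  toAdelic := toAdelic F E c N J
  Local v := «local» E c N J v
  toLocal v := toLocal E c N J v
  continuous_toLocal v :=
    continuous_unitaryGroupOfFormMap _ _ _ (continuous_adeleToLocal E v)
  center' := ⊥
  center'_le := bot_le

end UnitaryGroup

/-! ## Standard (split rational) forms -/

/-- A **standard form**: an integer matrix `J₀` with `J₀ᵀ = J₀` and `J₀² = 1` (e.g. Mok's
anti-diagonal `J_N`, the signature forms `diag(1, …, 1, -1, …, -1)`, `J₀ = 1`). Over a quadratic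
extension `E/F` such a `J₀` is a Hermitian matrix with entries in `ℤ ⊆ F`; these are exactly the
hypotheses under which `U(J₀)(E ⊗ ℝ)` is stable under the conjugate transpose of
`GL_N(E ⊗ ℝ)` in the given coordinates (needed for the tree's `RealMatrixGroup`). [folklore] -/
structure StdForm (N : ℕ) where
  /-- The integer matrix of the form. -/
  J : Matrix (Fin N) (Fin N) ℤ
  /-- `J` is symmetric. -/
  transpose_eq : Jᵀ = J
  /-- `J` is an involution. -/
  mul_self : J * J = 1

namespace StdForm

variable {N : ℕ} (S : StdForm N)

/-- The form over a ring `R` (entrywise `Int.cast`). [folklore] -/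
def over (R : Type*) [Ring R] : Matrix (Fin N) (Fin N) R := S.J.map (Int.castRingHom R)

/-- `S.over R` is symmetric. [folklore] -/
@[simp] theorem transpose_over (R : Type*) [Ring R] : (S.over R)ᵀ = S.over R := by
  rw [over, ← Matrix.transpose_map, S.transpose_eq]

/-- `S.over R` is an involution. [folklore] -/
@[simp] theorem over_mul_over (R : Type*) [Ring R] : S.over R * S.over R = 1 := by
  rw [over, ← Matrix.map_mul, S.mul_self, Matrix.map_one _ (map_zero _) (map_one _)]

/-- `S.over R` is invertible. [folklore] -/
theorem isUnit_over (R : Type*) [CommRing R] : IsUnit (S.over R) :=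
  ⟨⟨S.over R, S.over R, S.over_mul_over R, S.over_mul_over R⟩, rfl⟩

/-- `(S.over R)⁻¹ = S.over R`. [folklore] -/
@[simp] theorem inv_over (R : Type*) [CommRing R] : (S.over R)⁻¹ = S.over R :=
  Matrix.inv_eq_left_inv (S.over_mul_over R)

/-- Ring homomorphisms preserve the form: `(S.over R).map f = S.over R'`. [folklore] -/
@[simp] theorem over_map {R R' : Type*} [Ring R] [Ring R'] (f : R →+* R') :
    (S.over R).map f = S.over R' := by
  rw [over, over, Matrix.map_map]
  congr 1
  funext x
  simp

/-- Entrywise `star` fixes the form (its entries are integers). [folklore] -/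
@[simp] theorem over_map_star (R : Type*) [CommRing R] [StarRing R] :
    (S.over R).map star = S.over R := by
  rw [over, Matrix.map_map]
  congr 1
  funext x
  simp

/-- **Mok's anti-diagonal form** `J_N = antidiag(1, …, 1)` defining the quasi-split unitary group
`U_{E/F}(N)` (Mok 2014, §1 Notation, p. 5). [cite: Mok2014, §1 Notation p. 5] -/
def antidiagonal (N : ℕ) : StdForm N where
  J := Matrix.of fun i j => if j = i.rev then 1 else 0
  transpose_eq := by
    ext i j
    simp only [Matrix.transpose_apply, Matrix.of_apply]
    by_cases h : j = i.rev
    · subst h; simp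
    · rw [if_neg, if_neg h]
      rintro rfl; exact h (Fin.rev_rev j).symm
  mul_self := by
    ext i j
    simp only [Matrix.mul_apply, Matrix.of_apply, Matrix.one_apply, ite_mul, one_mul, zero_mul,
      Finset.sum_ite_eq', Finset.mem_univ, if_true]
    simp [eq_comm]

/-- Entries of Mok's form. [cite: Mok2014, §1 Notation p. 5] -/
@[simp] theorem antidiagonal_J_apply (N : ℕ) (i j : Fin N) :
    (antidiagonal N).J i j = if j = i.rev then 1 else 0 := by
  simp [antidiagonal]

/-- The form `J₀ = 1` (compact unitary groups `U(N)` when `E/F` is CM). [folklore] -/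
def one (N : ℕ) : StdForm N where
  J := 1
  transpose_eq := Matrix.transpose_one
  mul_self := Matrix.mul_one 1

end StdForm

/-! ## The archimedean group `U(J₀)(E ⊗_ℚ ℝ)` as a linear real group -/

namespace UnitaryGroup

-- Mathlib idiom (Mathlib/Algebra/Lie/OfAssociative.lean); needed to mention Lie subalgebras of matrix algebras
attribute [local instance 100] LieRing.ofAssociativeRing

open NumberField.mixedEmbedding NumberField.InfinitePlace
open scoped Classical

variable (F E : Type) [Field F] [Field E] [NumberField E] [Algebra F E] (c : E ≃ₐ[F] E) (N : ℕ)

/-- The conjugation `c ⊗ 1` of `E ⊗_ℚ ℝ = ℝ^{r₁} × ℂ^{r₂}` (`mixedSpace E`), transported from the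
accepted action on `E_∞ = InfiniteAdeleRing E` (`GaloisActionAdeleRing`) along Mathlib's
`InfiniteAdeleRing.ringEquiv_mixedSpace`. [cite: CasselsFrohlichANT1967, Ch. VII §1.1] -/
def conjMixed : mixedSpace E →+* mixedSpace E :=
  (InfiniteAdeleRing.ringEquiv_mixedSpace E).toRingHom.comp
    ((MulSemiringAction.toRingHom (E ≃ₐ[F] E) (InfiniteAdeleRing E) c).comp
      (InfiniteAdeleRing.ringEquiv_mixedSpace E).symm.toRingHom)

omit [NumberField E] in
/-- `conjMixed c (e y) = e (c • y)` for `e = ringEquiv_mixedSpace` (transport formula). [folklore] -/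
@[simp] theorem conjMixed_ringEquiv (y : InfiniteAdeleRing E) :
    conjMixed F E c (InfiniteAdeleRing.ringEquiv_mixedSpace E y) =
      InfiniteAdeleRing.ringEquiv_mixedSpace E (c • y) := by
  change InfiniteAdeleRing.ringEquiv_mixedSpace E
    (c • (InfiniteAdeleRing.ringEquiv_mixedSpace E).symm (InfiniteAdeleRing.ringEquiv_mixedSpace E y)) = _
  rw [RingEquiv.symm_apply_apply]

omit [NumberField E] in
/-- `e.symm (conjMixed c x) = c • e.symm x`. [folklore] -/
theorem ringEquiv_symm_conjMixed (x : mixedSpace E) :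
    (InfiniteAdeleRing.ringEquiv_mixedSpace E).symm (conjMixed F E c x) =
      c • (InfiniteAdeleRing.ringEquiv_mixedSpace E).symm x := by
  change (InfiniteAdeleRing.ringEquiv_mixedSpace E).symm (InfiniteAdeleRing.ringEquiv_mixedSpace E
    (c • (InfiniteAdeleRing.ringEquiv_mixedSpace E).symm x)) = _
  rw [RingEquiv.symm_apply_apply]

omit [NumberField E] in
/-- `conjMixed` is continuous. [folklore] -/
theorem continuous_conjMixed : Continuous (conjMixed F E c) :=
  (continuous_ringEquiv_mixedSpace E).comp ((InfiniteAdeleRing.continuous_smul F c).comp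
    (continuous_ringEquiv_mixedSpace_symm E))

omit [NumberField E] in
/-- `conjMixed` is `ℝ`-linear (a continuous additive map of real vector spaces). [folklore] -/
theorem conjMixed_real_smul (r : ℝ) (x : mixedSpace E) :
    conjMixed F E c (r • x) = r • conjMixed F E c x :=
  map_real_smul (conjMixed F E c) (continuous_conjMixed F E c) r x

omit [NumberField E] in
/-- The complex coordinate of `conjMixed c x` at `w'`: it is `ψ (x_{c⁻¹ w'})` for the continuous
ring homomorphism `ψ = ι_{w'} ∘ c ∘ ι_{c⁻¹ w'}⁻¹ : ℂ → ℂ` (`ι_w : E_w ≃ ℂ` Mathlib's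
`ringEquivComplexOfIsComplex`). [folklore] -/
theorem conjMixed_snd_apply (x : mixedSpace E) (w' : {w : InfinitePlace E // IsComplex w}) :
    (conjMixed F E c x).2 w' =
      (Completion.ringEquivComplexOfIsComplex w'.2)
        (galInfiniteCompletionMap c (smul_inv_smul c w'.1)
          ((Completion.ringEquivComplexOfIsComplex (isComplex_smul_iff.mpr w'.2 :
              IsComplex (c⁻¹ • w'.1))).symm
            (x.2 ⟨c⁻¹ • w'.1, isComplex_smul_iff.mpr w'.2⟩))) := by
  obtain ⟨y, rfl⟩ := (InfiniteAdeleRing.ringEquiv_mixedSpace E).surjective x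
  rw [conjMixed_ringEquiv]
  simp only [InfiniteAdeleRing.ringEquiv_mixedSpace_apply,
    Completion.ringEquivComplexOfIsComplex_apply]
  congr 1
  exact congrArg (galInfiniteCompletionMap c (smul_inv_smul c w'.1))
    ((Completion.ringEquivComplexOfIsComplex _).symm_apply_apply _).symm

omit [NumberField E] in
/-- The real coordinate of `conjMixed c x` at `w'`. [folklore] -/
theorem conjMixed_fst_apply (x : mixedSpace E) (w' : {w : InfinitePlace E // IsReal w}) :
    (conjMixed F E c x).1 w' =
      (Completion.ringEquivRealOfIsReal w'.2)
        (galInfiniteCompletionMap c (smul_inv_smul c w'.1)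
          ((Completion.ringEquivRealOfIsReal (isReal_smul_iff.mpr w'.2 :
              IsReal (c⁻¹ • w'.1))).symm
            (x.1 ⟨c⁻¹ • w'.1, isReal_smul_iff.mpr w'.2⟩))) := by
  obtain ⟨y, rfl⟩ := (InfiniteAdeleRing.ringEquiv_mixedSpace E).surjective x
  rw [conjMixed_ringEquiv]
  simp only [InfiniteAdeleRing.ringEquiv_mixedSpace_apply,
    Completion.ringEquivRealOfIsReal_apply]
  congr 1
  exact congrArg (galInfiniteCompletionMap c (smul_inv_smul c w'.1))
    ((Completion.ringEquivRealOfIsReal _).symm_apply_apply _).symm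

/-- A continuous ring homomorphism `ℂ → ℂ` commutes with complex conjugation (it is the identity
or the conjugation, Mathlib `Complex.ringHom_eq_id_or_conj_of_continuous`). [folklore] -/
theorem _root_.Complex.star_map_of_continuous (ψ : ℂ →+* ℂ) (hψ : Continuous ψ) (z : ℂ) :
    star (ψ z) = ψ (star z) := by
  rcases Complex.ringHom_eq_id_or_conj_of_continuous hψ with rfl | rfl
  · rfl
  · simp

omit [NumberField E] in
/-- **`c ⊗ 1` commutes with the involution of `E ⊗ ℝ = ℝ^{r₁} × ℂ^{r₂}`** (identity on the real
coordinates, complex conjugation on the complex ones): at a complex coordinate `c ⊗ 1` is a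
continuous ring homomorphism `ℂ → ℂ`, hence `id` or `conj`. [folklore] -/
theorem star_conjMixed (x : mixedSpace E) : star (conjMixed F E c x) = conjMixed F E c (star x) := by
  refine Prod.ext (funext fun w' => ?_) (funext fun w' => ?_)
  · change star ((conjMixed F E c x).1 w') = (conjMixed F E c (star x)).1 w'
    rw [star_trivial, conjMixed_fst_apply, conjMixed_fst_apply]
    rfl
  · change star ((conjMixed F E c x).2 w') = (conjMixed F E c (star x)).2 w'
    rw [conjMixed_snd_apply, conjMixed_snd_apply]
    have h₀ : IsComplex (c⁻¹ • w'.1) := isComplex_smul_iff.mpr w'.2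
    let ψ : ℂ →+* ℂ := (Completion.ringEquivComplexOfIsComplex w'.2).toRingHom.comp
      ((galInfiniteCompletionMap c (smul_inv_smul c w'.1)).comp
        (Completion.ringEquivComplexOfIsComplex h₀).symm.toRingHom)
    have hψc : Continuous ψ :=
      (Completion.isometryEquivComplexOfIsComplex w'.2).continuous.comp
        ((continuous_galInfiniteCompletionMap F c (smul_inv_smul c w'.1)).comp
          (Completion.isometryEquivComplexOfIsComplex h₀).symm.continuous)
    exact Complex.star_map_of_continuous ψ hψc (x.2 ⟨c⁻¹ • w'.1, h₀⟩)

/-- The standard form over `E ⊗ ℝ`. [folklore] -/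
abbrev archForm (S : StdForm N) : Matrix (Fin N) (Fin N) (mixedSpace E) := S.over (mixedSpace E)

/-- The Lie algebra `𝔲(J₀)(E ⊗ ℝ) = {X ∈ 𝔤𝔩_N(E ⊗ ℝ) | ((c ⊗ 1) X)ᵀ J₀ + J₀ X = 0}` of the
archimedean unitary group, a real Lie subalgebra of `𝔤𝔩_N(E ⊗ ℝ)` (commutator bracket).
Knapp 2002, I.§1 Example (classical groups defined by forms); Mok 2014, §1. [folklore] -/
def archLie (S : StdForm N) : LieSubalgebra ℝ (Matrix (Fin N) (Fin N) (mixedSpace E)) where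
  carrier := {X | (X.map (conjMixed F E c))ᵀ * archForm E N S + archForm E N S * X = 0}
  zero_mem' := by simp [Matrix.map_zero _ (map_zero _)]
  add_mem' {X Y} hX hY := by
    simp only [Set.mem_setOf_eq] at hX hY ⊢
    rw [Matrix.map_add _ (map_add _), Matrix.transpose_add, Matrix.add_mul, Matrix.mul_add,
      add_add_add_comm, hX, hY, add_zero]
  smul_mem' t X hX := by
    simp only [Set.mem_setOf_eq] at hX ⊢
    rw [Matrix.map_smul _ _ (conjMixed_real_smul F E c t), Matrix.transpose_smul, Matrix.smul_mul,
      Matrix.mul_smul, ← smul_add, hX, smul_zero]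
  lie_mem' {X Y} hX hY := by
    simp only [Set.mem_setOf_eq] at hX hY ⊢
    set J := archForm E N S
    set σ := conjMixed F E c
    have hX' : (X.map σ)ᵀ * J = -(J * X) := eq_neg_of_add_eq_zero_left hX
    have hY' : (Y.map σ)ᵀ * J = -(J * Y) := eq_neg_of_add_eq_zero_left hY
    rw [Ring.lie_def, Matrix.map_sub _ (map_sub _), Matrix.map_mul, Matrix.map_mul,
      Matrix.transpose_sub, Matrix.transpose_mul, Matrix.transpose_mul]
    calc ((Y.map σ)ᵀ * (X.map σ)ᵀ - (X.map σ)ᵀ * (Y.map σ)ᵀ) * J + J * (X * Y - Y * X)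
        = (Y.map σ)ᵀ * ((X.map σ)ᵀ * J) - (X.map σ)ᵀ * ((Y.map σ)ᵀ * J) + J * (X * Y - Y * X) := by
          noncomm_ring
      _ = (Y.map σ)ᵀ * (-(J * X)) - (X.map σ)ᵀ * (-(J * Y)) + J * (X * Y - Y * X) := by
          rw [hX', hY']
      _ = -((Y.map σ)ᵀ * J) * X + ((X.map σ)ᵀ * J) * Y + J * (X * Y - Y * X) := by
          noncomm_ring
      _ = -(-(J * Y)) * X + (-(J * X)) * Y + J * (X * Y - Y * X) := by rw [hX', hY']
      _ = 0 := by noncomm_ring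

omit [NumberField E] in
/-- Membership in `𝔲(J₀)(E ⊗ ℝ)` (definitional). [folklore] -/
theorem mem_archLie_iff (S : StdForm N) (X : Matrix (Fin N) (Fin N) (mixedSpace E)) :
    X ∈ archLie F E c N S ↔ (X.map (conjMixed F E c))ᵀ * archForm E N S + archForm E N S * X = 0 :=
  Iff.rfl

omit [NumberField E] in
/-- `conjMixed c⁻¹` is a left inverse of `conjMixed c`. [folklore] -/
@[simp] theorem conjMixed_inv_apply (x : mixedSpace E) : conjMixed F E c⁻¹ (conjMixed F E c x) = x := by
  change InfiniteAdeleRing.ringEquiv_mixedSpace E (c⁻¹ • (InfiniteAdeleRing.ringEquiv_mixedSpace E).symm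
    (InfiniteAdeleRing.ringEquiv_mixedSpace E (c • (InfiniteAdeleRing.ringEquiv_mixedSpace E).symm x))) = x
  rw [RingEquiv.symm_apply_apply, inv_smul_smul, RingEquiv.apply_symm_apply]

omit [NumberField E] in
/-- Entrywise `c ⊗ 1` commutes with the matrix exponential over `E ⊗ ℝ`: it is a continuous ring
automorphism of `M_N(E ⊗ ℝ)` (with continuous inverse `c⁻¹ ⊗ 1`), so it commutes with the
exponential series term by term (Mathlib `NormedSpace.exp_eq_tsum_rat`,
`Function.LeftInverse.map_tsum`; no matrix norm is needed). [folklore] -/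
theorem map_conjMixed_exp (X : Matrix (Fin N) (Fin N) (mixedSpace E)) :
    (NormedSpace.exp X).map (conjMixed F E c) = NormedSpace.exp (X.map (conjMixed F E c)) := by
  rw [congrFun NormedSpace.exp_eq_tsum_rat X, congrFun NormedSpace.exp_eq_tsum_rat (X.map _)]
  change (conjMixed F E c).mapMatrix (∑' n : ℕ, ((Nat.factorial n)⁻¹ : ℚ) • X ^ n) = _
  rw [Function.LeftInverse.map_tsum (g := (conjMixed F E c).mapMatrix)
    (g' := (conjMixed F E c⁻¹).mapMatrix) _ (continuous_id.matrix_map (continuous_conjMixed F E c))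
    (continuous_id.matrix_map (continuous_conjMixed F E c⁻¹))
    (fun M => Matrix.ext fun i j => conjMixed_inv_apply F E c (M i j))]
  congr 1
  funext n
  rw [map_rat_smul, map_pow]
  rfl

/-- `exp (-A) * exp A = 1` for matrices over `E ⊗ ℝ`. [folklore] -/
theorem exp_neg_mul_exp (A : Matrix (Fin N) (Fin N) (mixedSpace E)) :
    NormedSpace.exp (-A) * NormedSpace.exp A = 1 := by
  rw [Matrix.exp_neg]
  exact Matrix.nonsing_inv_mul _ ((Matrix.isUnit_iff_isUnit_det _).mp (Matrix.isUnit_exp _))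

variable {F E c N} in
omit [NumberField E] in
/-- In `U(J₀)`: `(σ g)ᵀ J = J g⁻¹`. [folklore] -/
theorem map_transpose_mul_form {S : StdForm N} {g : GL (Fin N) (mixedSpace E)}
    (hg : g ∈ unitaryGroupOfForm (conjMixed F E c) (archForm E N S)) :
    ((g : Matrix (Fin N) (Fin N) (mixedSpace E)).map (conjMixed F E c))ᵀ * archForm E N S =
      archForm E N S * ((g⁻¹ : GL (Fin N) (mixedSpace E)) : Matrix (Fin N) (Fin N) (mixedSpace E)) := by
  rw [mem_unitaryGroupOfForm_iff] at hg
  calc ((g : Matrix (Fin N) (Fin N) (mixedSpace E)).map (conjMixed F E c))ᵀ * archForm E N S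
      = ((g : Matrix (Fin N) (Fin N) (mixedSpace E)).map (conjMixed F E c))ᵀ * archForm E N S *
          ((g : Matrix (Fin N) (Fin N) (mixedSpace E)) *
            ((g⁻¹ : GL (Fin N) (mixedSpace E)) : Matrix (Fin N) (Fin N) (mixedSpace E))) := by
        rw [← Units.val_mul, mul_inv_cancel, Units.val_one, Matrix.mul_one]
    _ = archForm E N S * ((g⁻¹ : GL (Fin N) (mixedSpace E)) : Matrix _ _ _) := by
        rw [← Matrix.mul_assoc, hg]

variable {F E c N} in
omit [NumberField E] in
/-- In `U(J₀)`: `J g = (σ g⁻¹)ᵀ J`. [folklore] -/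
theorem form_mul_eq {S : StdForm N} {g : GL (Fin N) (mixedSpace E)}
    (hg : g ∈ unitaryGroupOfForm (conjMixed F E c) (archForm E N S)) :
    archForm E N S * (g : Matrix (Fin N) (Fin N) (mixedSpace E)) =
      (((g⁻¹ : GL (Fin N) (mixedSpace E)) : Matrix (Fin N) (Fin N) (mixedSpace E)).map
        (conjMixed F E c))ᵀ * archForm E N S := by
  have h := map_transpose_mul_form (inv_mem hg)
  rw [inv_inv] at h
  exact h.symm

/-- **The archimedean unitary group `U(J₀)(E ⊗ ℝ) = ∏_{v ∣ ∞} U(J₀)(F_v)` as a linear real group**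
in `GL_N(E ⊗ ℝ)` (`RealMatrixGroup` over `mixedSpace E`): carrier `{g | ((c ⊗ 1) g)ᵀ J₀ g = J₀}`,
Lie algebra `𝔲(J₀)`, closed, `exp`-closed, `Ad`-stable and — because `J₀` is a symmetric
involution with integer entries and `c ⊗ 1` commutes with the involution of `E ⊗ ℝ` — stable under
the conjugate transpose. Knapp 2002, I.§1 and VII.§2 Example 2 (closed linear groups stable under
conjugate transpose); Mok 2014, §1. [folklore] -/
def archGroup (S : StdForm N) : RealMatrixGroup (mixedSpace E) (Fin N) where
  carrier := unitaryGroupOfForm (conjMixed F E c) (archForm E N S)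
  lie := archLie F E c N S
  expGL_smul_mem X hX t := by
    set J := archForm E N S with hJ
    have hJJ : J * J = 1 := S.over_mul_over _
    rw [mem_unitaryGroupOfForm_iff, coe_expGL]
    have h := (archLie F E c N S).smul_mem t hX
    rw [mem_archLie_iff, ← hJ] at h
    have h1 : ((t • X).map (conjMixed F E c))ᵀ * J = -(J * (t • X)) := eq_neg_of_add_eq_zero_left h
    have hX' : ((t • X).map (conjMixed F E c))ᵀ = J * (-(t • X)) * J⁻¹ := by
      rw [S.inv_over]
      calc ((t • X).map (conjMixed F E c))ᵀ = ((t • X).map (conjMixed F E c))ᵀ * (J * J) := by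
            rw [hJJ, Matrix.mul_one]
        _ = (((t • X).map (conjMixed F E c))ᵀ * J) * J := by rw [Matrix.mul_assoc]
        _ = J * (-(t • X)) * J := by rw [h1, Matrix.mul_neg, Matrix.neg_mul]
    rw [map_conjMixed_exp, ← Matrix.exp_transpose, hX', Matrix.exp_conj _ _ (S.isUnit_over _),
      S.inv_over]
    calc J * NormedSpace.exp (-(t • X)) * J * J * NormedSpace.exp (t • X)
        = J * (NormedSpace.exp (-(t • X)) * ((J * J) * NormedSpace.exp (t • X))) := by
          simp only [Matrix.mul_assoc]
      _ = J := by rw [hJJ, Matrix.one_mul, exp_neg_mul_exp, Matrix.mul_one]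
  conj_mem_lie g hg X hX := by
    rw [mem_archLie_iff] at hX ⊢
    set J := archForm E N S with hJ
    set σ := conjMixed F E c with hσ
    have hX' : (X.map σ)ᵀ * J = -(J * X) := eq_neg_of_add_eq_zero_left hX
    have hi := form_mul_eq hg
    have hii := map_transpose_mul_form hg
    rw [← hJ, ← hσ] at hi hii
    rw [Matrix.map_mul, Matrix.map_mul, Matrix.transpose_mul, Matrix.transpose_mul]
    set G : Matrix (Fin N) (Fin N) (mixedSpace E) := (g : GL (Fin N) (mixedSpace E)).val
    set G' : Matrix (Fin N) (Fin N) (mixedSpace E) := (g⁻¹ : GL (Fin N) (mixedSpace E)).val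
    calc (G'.map σ)ᵀ * ((X.map σ)ᵀ * (G.map σ)ᵀ) * J + J * (G * X * G')
        = (G'.map σ)ᵀ * (X.map σ)ᵀ * ((G.map σ)ᵀ * J) + J * G * X * G' := by noncomm_ring
      _ = (G'.map σ)ᵀ * (X.map σ)ᵀ * (J * G') + (G'.map σ)ᵀ * J * X * G' := by rw [hii, hi]
      _ = (G'.map σ)ᵀ * ((X.map σ)ᵀ * J) * G' + (G'.map σ)ᵀ * J * X * G' := by noncomm_ring
      _ = (G'.map σ)ᵀ * (-(J * X)) * G' + (G'.map σ)ᵀ * J * X * G' := by rw [hX']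
      _ = 0 := by noncomm_ring
  star_mem g hg := by
    rw [mem_unitaryGroupOfForm_iff] at hg ⊢
    set J := archForm E N S with hJ
    set σ := conjMixed F E c with hσ
    set τ := starRingEnd (mixedSpace E) with hτ
    have hJJ : J * J = 1 := S.over_mul_over _
    set B := (g : GL (Fin N) (mixedSpace E)).val.map τ with hB
    -- `ḡ ∈ U`: apply entrywise `star` to the defining equation
    have hbar : (B.map σ)ᵀ * J * B = J := by
      have h := congrArg (fun M : Matrix (Fin N) (Fin N) (mixedSpace E) => M.map τ) hg
      simp only [Matrix.map_mul, Matrix.transpose_map, Matrix.map_map] at h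
      rw [show J.map τ = J from S.over_map τ] at h
      rw [hB, Matrix.map_map, show (σ ∘ τ : mixedSpace E → mixedSpace E) = τ ∘ σ from
          funext fun x => (star_conjMixed F E c x).symm]
      exact h
    -- the underlying matrix of `star g` is `Bᵀ`
    have hstar : (star g : GL (Fin N) (mixedSpace E)).val = Bᵀ := by
      rw [hB, ← Matrix.transpose_map]; rfl
    rw [hstar, Matrix.transpose_map, Matrix.transpose_transpose]
    -- transpose `hbar`: `Bᵀ J (σ B) = J`, then swap the one-sided inverse
    have hJt : Jᵀ = J := S.transpose_over _
    have ht : Bᵀ * J * B.map σ = J := by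
      have h := congrArg Matrix.transpose hbar
      rwa [Matrix.transpose_mul, Matrix.transpose_mul, Matrix.transpose_transpose, hJt,
        ← Matrix.mul_assoc] at h
    have h1 : (J * Bᵀ) * (J * B.map σ) = 1 := by
      calc (J * Bᵀ) * (J * B.map σ) = J * (Bᵀ * J * B.map σ) := by noncomm_ring
        _ = 1 := by rw [ht, hJJ]
    have h2 := mul_eq_one_comm.mp h1
    calc B.map σ * J * Bᵀ = (J * J) * B.map σ * J * Bᵀ := by rw [hJJ, Matrix.one_mul]
      _ = J * ((J * B.map σ) * (J * Bᵀ)) := by noncomm_ring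
      _ = J := by rw [h2, Matrix.mul_one]
  isClosed := by
    have : ((unitaryGroupOfForm (conjMixed F E c) (archForm E N S) :
        Subgroup (GL (Fin N) (mixedSpace E))) : Set (GL (Fin N) (mixedSpace E))) =
        (fun g : GL (Fin N) (mixedSpace E) =>
          (((g : Matrix (Fin N) (Fin N) (mixedSpace E)).map (conjMixed F E c))ᵀ * archForm E N S *
            (g : Matrix (Fin N) (Fin N) (mixedSpace E)))) ⁻¹' {archForm E N S} := rfl
    rw [this]
    refine IsClosed.preimage ?_ isClosed_singleton
    exact ((Units.continuous_val.matrix_map (continuous_conjMixed F E c)).matrix_transpose.mul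
      continuous_const).mul Units.continuous_val

/-! ## `U(J₀)(E ⊗ ℝ) → U(J₀)(𝔸_F)` and the automorphy datum -/

variable [NumberField F] (S : StdForm N)

/-- The adelic form attached to a standard form is `S.over 𝔸_E`. [folklore] -/
theorem adelicForm_over : adelicForm E N (S.over E) = S.over (AdeleRing (𝓞 E) E) :=
  S.over_map _

/-- The projection `𝔸_E →+* E_∞` (Mathlib `RingHom.fst`, typed on `AdeleRing`). [folklore] -/
def adeleFst : AdeleRing (𝓞 E) E →+* InfiniteAdeleRing E := RingHom.fst _ _

/-- The projection `𝔸_E →+* 𝔸_E^∞` (Mathlib `RingHom.snd`, typed on `AdeleRing`). [folklore] -/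
def adeleSnd : AdeleRing (𝓞 E) E →+* FiniteAdeleRing (𝓞 E) E := RingHom.snd _ _

omit [NumberField F] in
/-- Two matrices over `𝔸_E = E_∞ × 𝔸_E^∞` agree iff their archimedean and finite parts agree. [folklore] -/
theorem matrix_adele_ext {M M' : Matrix (Fin N) (Fin N) (AdeleRing (𝓞 E) E)}
    (h₁ : M.map (adeleFst E) = M'.map (adeleFst E)) (h₂ : M.map (adeleSnd E) = M'.map (adeleSnd E)) :
    M = M' :=
  Matrix.ext fun i j => Prod.ext (congrFun (congrFun h₁ i) j) (congrFun (congrFun h₂ i) j)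

omit [NumberField F] in
/-- The archimedean part of `GLn.ofInfinite g` is `g` transported to `GL_N(E_∞)`. [folklore] -/
theorem map_fst_ofInfinite (g : GL (Fin N) (mixedSpace E)) :
    (GLn.ofInfinite N E g).val.map (adeleFst E) =
      g.val.map (InfiniteAdeleRing.ringEquiv_mixedSpace E).symm.toRingHom := by
  ext i j
  simp only [Matrix.map_apply]
  rw [GLn.coe_ofInfinite_apply]
  rfl

omit [NumberField F] in
/-- The finite part of `GLn.ofInfinite g` is `1`. [folklore] -/
theorem map_snd_ofInfinite (g : GL (Fin N) (mixedSpace E)) :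
    (GLn.ofInfinite N E g).val.map (adeleSnd E) = 1 := by
  ext i j
  simp only [Matrix.map_apply]
  rw [GLn.coe_ofInfinite_apply]
  rfl

omit [NumberField F] in
/-- **`(g, 1) ∈ U(J₀)(𝔸_F)` for `g ∈ U(J₀)(E ⊗ ℝ)`**: the unitary condition on `GL_N(𝔸_E)` splits into
its archimedean part (the transport of the condition on `GL_N(E ⊗ ℝ)`, since `c ⊗ 1` on `E ⊗ ℝ` is by
definition the transport of the action on `E_∞`) and its finite part (trivial). [folklore] -/
theorem ofInfinite_mem_adelic {g : GL (Fin N) (mixedSpace E)}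
    (hg : g ∈ (archGroup F E c N S).carrier) :
    GLn.ofInfinite N E g ∈ adelic F E c N (S.over E) := by
  change g ∈ unitaryGroupOfForm (conjMixed F E c) (archForm E N S) at hg
  rw [mem_unitaryGroupOfForm_iff] at hg
  rw [adelic, adelicForm_over, mem_unitaryGroupOfForm_iff]
  set G : Matrix (Fin N) (Fin N) (AdeleRing (𝓞 E) E) := (GLn.ofInfinite N E g).val with hG
  set e' := (InfiniteAdeleRing.ringEquiv_mixedSpace E).symm.toRingHom with he'
  have hfst : G.map (adeleFst E) = g.val.map e' := map_fst_ofInfinite E N g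
  have hsnd : G.map (adeleSnd E) = 1 := map_snd_ofInfinite E N g
  have hσfst : (G.map (conjAdele F E c)).map (adeleFst E) = (g.val.map (conjMixed F E c)).map e' := by
    rw [Matrix.map_map, Matrix.map_map,
      show (adeleFst E ∘ conjAdele F E c : AdeleRing (𝓞 E) E → InfiniteAdeleRing E) =
        (MulSemiringAction.toRingHom (E ≃ₐ[F] E) (InfiniteAdeleRing E) c) ∘ adeleFst E from rfl,
      ← Matrix.map_map, hfst, Matrix.map_map]
    congr 1
    funext x
    exact (ringEquiv_symm_conjMixed F E c x).symm
  have hσsnd : (G.map (conjAdele F E c)).map (adeleSnd E) = 1 := by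
    rw [Matrix.map_map,
      show (adeleSnd E ∘ conjAdele F E c : AdeleRing (𝓞 E) E → FiniteAdeleRing (𝓞 E) E) =
        (MulSemiringAction.toRingHom (E ≃ₐ[F] E) (FiniteAdeleRing (𝓞 E) E) c) ∘ adeleSnd E from rfl,
      ← Matrix.map_map, hsnd, Matrix.map_one _ (map_zero _) (map_one _)]
  refine matrix_adele_ext E N ?_ ?_
  · rw [Matrix.map_mul, Matrix.map_mul, Matrix.transpose_map, hσfst, hfst, S.over_map]
    have key := congrArg (fun M : Matrix (Fin N) (Fin N) (mixedSpace E) => M.map e') hg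
    simp only [Matrix.map_mul, Matrix.transpose_map] at key
    rw [he', S.over_map, ← he'] at key
    exact key
  · rw [Matrix.map_mul, Matrix.map_mul, Matrix.transpose_map, hσsnd, hsnd, S.over_map,
      Matrix.transpose_one, Matrix.one_mul, Matrix.mul_one]

/-- The inclusion `U(J)(𝔸_F) →* GL_N(𝔸_E)` of the adelic points of the datum (the subgroup
inclusion, typed on `(adelicGroupData …).Adelic`). [folklore] -/
def adelicVal (J : Matrix (Fin N) (Fin N) E) :
    (adelicGroupData F E c N J).Adelic →* GL (Fin N) (AdeleRing (𝓞 E) E) :=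
  (adelic F E c N J).subtype

/-- `adelicVal` is the coercion (definitional). [folklore] -/
theorem adelicVal_apply (J : Matrix (Fin N) (Fin N) E) (g : adelic F E c N J) :
    adelicVal F E c N J g = (g : GL (Fin N) (AdeleRing (𝓞 E) E)) := rfl

/-- `adelicVal` is injective. [folklore] -/
theorem adelicVal_injective (J : Matrix (Fin N) (Fin N) E) : Function.Injective (adelicVal F E c N J) :=
  Subtype.val_injective

/-- The inclusion `U(J₀)(E ⊗ ℝ) →* U(J₀)(𝔸_F)`, `g ↦ (g, 1)` (restriction of the accepted
`GLn.ofInfinite`). Borel–Jacquet 1979, §4.1. [cite: BorelJacquet1979, §4.1] -/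
def ofArch : (archGroup F E c N S).carrier →* (adelicGroupData F E c N (S.over E)).Adelic :=
  ((GLn.ofInfinite N E).comp (archGroup F E c N S).carrier.subtype).codRestrict
    (adelic F E c N (S.over E)) fun g => ofInfinite_mem_adelic F E c N S g.2

/-- `ofArch g = (g, 1)` in `GL_N(𝔸_E)`. [folklore] -/
@[simp] theorem adelicVal_ofArch (g : (archGroup F E c N S).carrier) :
    adelicVal F E c N (S.over E) (ofArch F E c N S g) = GLn.ofInfinite N E g := rfl

/-- `ofArch` is continuous. [folklore] -/
theorem continuous_ofArch : Continuous (ofArch F E c N S) :=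
  Continuous.subtype_mk ((GLn.continuous_ofInfinite N E).comp continuous_subtype_val) _

/-- The finite-adelic points `U(J₀)(𝔸_F^∞) = U(J₀)(𝔸_F) ∩ ({1} × GL_N(𝔸_E^∞))`. [folklore] -/
def finiteAdelic (J : Matrix (Fin N) (Fin N) E) : Subgroup (adelicGroupData F E c N J).Adelic :=
  ((GLn.ofFinite N E).range).comap (adelic F E c N J).subtype

/-- The admissible **levels** of `U(J)`: traces `U(J)(𝔸_F) ∩ ({1} × U₀)` of the compact open subgroups
`U₀ ≤ GL_N(𝔸_E^∞)` (every compact open subgroup of `U(J)(𝔸_F^∞)` is such a trace, `U(J)(𝔸_F^∞)`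
being closed in `GL_N(𝔸_E^∞)`). Borel–Jacquet 1979, §4.1. [cite: BorelJacquet1979, §4.1] -/
def finiteLevels (J : Matrix (Fin N) (Fin N) E) : Set (Subgroup (adelicGroupData F E c N J).Adelic) :=
  {L | ∃ U₀ : Subgroup (GL (Fin N) (FiniteAdeleRing (𝓞 E) E)),
    IsOpen (U₀ : Set (GL (Fin N) (FiniteAdeleRing (𝓞 E) E))) ∧
      IsCompact (U₀ : Set (GL (Fin N) (FiniteAdeleRing (𝓞 E) E))) ∧
        L = (U₀.map (GLn.ofFinite N E)).comap (adelic F E c N J).subtype}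

/-- The trace of `GL_N(𝒪̂_E)` is a level (given its compactness `hcpt`, the accepted named fact
`isCompact_glFiniteIntegralLevel`). [folklore] -/
theorem integralLevel_mem_finiteLevels (J : Matrix (Fin N) (Fin N) E)
    (hcpt : isCompact_glFiniteIntegralLevel N E) :
    ((glFiniteIntegralLevel N E).map (GLn.ofFinite N E)).comap (adelic F E c N J).subtype ∈
      finiteLevels F E c N J :=
  ⟨glFiniteIntegralLevel N E, isOpen_glFiniteIntegralLevel N E, hcpt, rfl⟩

/-- **The automorphy datum of `U(J₀)` over `F`** (Borel–Jacquet 1979, §4.1–4.2 for `G = U(J₀)`):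
`G_∞ = U(J₀)(E ⊗ ℝ)` (`archGroup`) embedded by `ofArch`, `G(𝔸_f)` the finite-adelic points,
levels the traces of compact open subgroups of `GL_N(𝔸_E^∞)`, height the restriction of the adelic
height of `GL_N(𝔸_E)`. As for `AutomorphyDatum.gl`, the compactness of `GL_N(𝒪̂_E)` (`hcpt`) is a
parameter. [cite: BorelJacquet1979, §4.1–4.2] -/
def automorphyDatum (hcpt : isCompact_glFiniteIntegralLevel N E) :
    AutomorphyDatum (adelicGroupData F E c N (S.over E)) (mixedSpace E) (Fin N) where
  arch := archGroup F E c N S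
  ofArch := ofArch F E c N S
  continuous_ofArch := continuous_ofArch F E c N S
  finiteAdelic := finiteAdelic F E c N (S.over E)
  commute_ofArch g := by
    rintro h ⟨h₀, hh₀⟩
    apply adelicVal_injective F E c N (S.over E)
    rw [map_mul, map_mul, adelicVal_ofArch]
    rw [show adelicVal F E c N (S.over E) h = GLn.ofFinite N E h₀ from hh₀.symm]
    exact (GLn.commute_ofInfinite_ofFinite (g : GL (Fin N) (mixedSpace E)) h₀).eq
  finiteLevels := finiteLevels F E c N (S.over E)
  finiteLevels_nonempty := ⟨_, integralLevel_mem_finiteLevels F E c N (S.over E) hcpt⟩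
  le_finiteAdelic L hL := by
    obtain ⟨U₀, -, -, rfl⟩ := hL
    exact Subgroup.comap_mono (Subgroup.map_le_range _ _)
  height g := adelicHeightGL N E (adelicVal F E c N (S.over E) g)

end UnitaryGroup

/-! ## Mok's quasi-split unitary group `U_{E/F}(N)`: cusp forms -/

namespace UnitaryGroup

open MeasureTheory
open scoped Classical

variable (F E : Type) [Field F] [NumberField F] [Field E] [NumberField E] [Algebra F E]
  (c : E ≃ₐ[F] E) (N : ℕ)

/-- **Mok's quasi-split unitary group `U_{E/F}(N)`** as an adelic group datum: the unitary group of
the anti-diagonal form `J_N` (Mok 2014, §1 Notation, p. 5). [cite: Mok2014, §1 Notation p. 5] -/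
abbrev quasiSplit : AdelicGroupData.{0} F :=
  adelicGroupData F E c N ((StdForm.antidiagonal N).over E)

/-- The automorphy datum of `U_{E/F}(N)` (`automorphyDatum` for Mok's form). [cite: Mok2014, §1 Notation p. 5] -/
abbrev quasiSplitDatum (hcpt : isCompact_glFiniteIntegralLevel N E) :
    AutomorphyDatum (quasiSplit F E c N) (NumberField.mixedEmbedding.mixedSpace E) (Fin N) :=
  automorphyDatum F E c N (StdForm.antidiagonal N) hcpt

/-- The unipotent radical `N_k(𝔸_F) = U_{E/F}(N)(𝔸_F) ∩ (1 + 𝔫_k(𝔸_E))` of the standard maximal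
parabolic `P_k` of `U_{E/F}(N)` stabilising the isotropic flag `⟨e_1, …, e_k⟩` (`1 ≤ k ≤ N/2`): an
element of `U(J_N)` acting trivially on `⟨e_1, …, e_k⟩` and on `E^N / ⟨e_1, …, e_k⟩` automatically
preserves `⟨e_1, …, e_k⟩^⊥ = ⟨e_1, …, e_{N-k}⟩`, so this is the full unipotent radical (a two-step
nilpotent group for `2k < N`). Uses the accepted `standardUnipotentRadical` of `GL_N`.
Mok 2014, §2.4 (standard parabolic subgroups of `U_{E/F}(N)`); Borel–Jacquet 1979, §4.4. [folklore] -/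
def unipotentRadical (k : ℕ) : Subgroup (quasiSplit F E c N).Adelic :=
  (standardUnipotentRadical N k (AdeleRing (𝓞 E) E)).comap (adelicVal F E c N _)

/-- The rational points `N_k(F) ≤ N_k(𝔸_F)` (elements in the image of `U(F) → U(𝔸_F)`). [folklore] -/
def rationalUnipotentRadical (k : ℕ) : Subgroup (unipotentRadical F E c N k) :=
  ((quasiSplit F E c N).arithmeticSubgroup).comap (unipotentRadical F E c N k).subtype

/-- The **constant term of `φ : U_{E/F}(N)(𝔸_F) → ℂ` along `P_k` vanishes**: for every σ-algebra making
`N_k(𝔸_F)` a Borel space, every Haar measure `ν` on it, every measurable fundamental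
domain `𝓕` for the left translation action of `N_k(F)` (so `𝓕 ≃ N_k(F) \ N_k(𝔸_F)`) and every `g`,
`u ↦ φ (u g)` is integrable on `𝓕` with integral `0`. (Multiplicative version of the accepted
`CuspConditionGL`: here `N_k` is not abelian, so the Haar measure of the group itself is used.)
Borel–Jacquet 1979, §4.4; Mok 2014, §2.4. [cite: BorelJacquet1979, 4.4] -/
def CuspCondition (φ : (quasiSplit F E c N).Adelic → ℂ) (k : ℕ) : Prop :=
  ∀ [MeasurableSpace (unipotentRadical F E c N k)] [BorelSpace (unipotentRadical F E c N k)]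
    (ν : Measure (unipotentRadical F E c N k)) [ν.IsHaarMeasure]
    (𝓕 : Set (unipotentRadical F E c N k)),
    IsFundamentalDomain (rationalUnipotentRadical F E c N k) 𝓕 ν →
      ∀ g : (quasiSplit F E c N).Adelic,
        IntegrableOn (fun u : unipotentRadical F E c N k =>
          φ ((u : (quasiSplit F E c N).Adelic) * g)) 𝓕 ν ∧
        ∫ u in 𝓕, φ ((u : (quasiSplit F E c N).Adelic) * g) ∂ν = 0

variable {F E c N} in
/-- The zero function satisfies the cusp condition. [folklore] -/
theorem CuspCondition.zero (k : ℕ) : CuspCondition F E c N 0 k := by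
  intro _ _ ν _ 𝓕 _ g
  exact ⟨integrableOn_zero, by simp⟩

variable {F E c N} in
/-- The cusp condition is preserved under sums. [folklore] -/
theorem CuspCondition.add {φ ψ : (quasiSplit F E c N).Adelic → ℂ} {k : ℕ}
    (hφ : CuspCondition F E c N φ k) (hψ : CuspCondition F E c N ψ k) :
    CuspCondition F E c N (φ + ψ) k := by
  intro _ _ ν _ 𝓕 h𝓕 g
  obtain ⟨hφi, hφ0⟩ := hφ ν 𝓕 h𝓕 g
  obtain ⟨hψi, hψ0⟩ := hψ ν 𝓕 h𝓕 g
  refine ⟨hφi.add hψi, ?_⟩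
  change ∫ u in 𝓕, φ _ + ψ _ ∂ν = 0
  rw [integral_add hφi hψi, hφ0, hψ0, add_zero]

variable {F E c N} in
/-- The cusp condition is preserved under scalar multiplication. [folklore] -/
theorem CuspCondition.smul {φ : (quasiSplit F E c N).Adelic → ℂ} {k : ℕ} (a : ℂ)
    (hφ : CuspCondition F E c N φ k) : CuspCondition F E c N (a • φ) k := by
  intro _ _ ν _ 𝓕 h𝓕 g
  obtain ⟨hφi, hφ0⟩ := hφ ν 𝓕 h𝓕 g
  refine ⟨hφi.smul a, ?_⟩
  change ∫ u in 𝓕, a • φ _ ∂ν = 0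
  rw [integral_smul, hφ0, smul_zero]

variable {F E c N} in
/-- The cusp condition is invariant under right translation. [folklore] -/
theorem CuspCondition.rightTranslation {φ : (quasiSplit F E c N).Adelic → ℂ} {k : ℕ}
    (hφ : CuspCondition F E c N φ k) (h : (quasiSplit F E c N).Adelic) :
    CuspCondition F E c N (rightTranslation (quasiSplit F E c N) h φ) k := by
  intro _ _ ν _ 𝓕 h𝓕 g
  simpa only [rightTranslation_apply, mul_assoc] using hφ ν 𝓕 h𝓕 (g * h)

variable (hcpt : isCompact_glFiniteIntegralLevel N E)

/-- `φ : U_{E/F}(N)(𝔸_F) → ℂ` is a **cusp form**: an automorphic form for `quasiSplitDatum` all of whose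
constant terms along the standard maximal parabolics `P_k`, `1 ≤ k ≤ N/2` (the Witt index of `J_N` is
`⌊N/2⌋`), vanish; for `N ≤ 1` the condition is empty. Borel–Jacquet 1979, §4.4; Mok 2014, §2.4. [cite: BorelJacquet1979, 4.4] -/
def IsCuspForm (φ : (quasiSplit F E c N).Adelic → ℂ) : Prop :=
  IsAutomorphicForm (quasiSplitDatum F E c N hcpt) φ ∧ ∀ k, 0 < k → 2 * k ≤ N → CuspCondition F E c N φ k

/-- The space of cusp forms on `U_{E/F}(N)` (complex span of the cusp forms). Borel–Jacquet 1979,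
§4.4–4.6. [cite: BorelJacquet1979, 4.4–4.6] -/
def cuspForms : Submodule ℂ ((quasiSplit F E c N).Adelic → ℂ) :=
  Submodule.span ℂ {φ | IsCuspForm F E c N hcpt φ}

variable {F E c N hcpt} in
/-- A cusp form lies in the space of cusp forms. [folklore] -/
theorem IsCuspForm.mem_cuspForms {φ : (quasiSplit F E c N).Adelic → ℂ} (hφ : IsCuspForm F E c N hcpt φ) :
    φ ∈ cuspForms F E c N hcpt :=
  Submodule.subset_span hφ

/-- **Cuspidal automorphic representations of `U_{E/F}(N)(𝔸_F)`** (as data): automorphic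
representation data `W' < W` of `quasiSplitDatum` realised on cusp forms (`W ≤ cuspForms`), exactly as
the accepted `CuspidalAutomorphicRepData` for `GL_n`. Borel–Jacquet 1979, 4.6; Mok 2014, §2.5. [cite: BorelJacquet1979, 4.6] -/
def CuspidalAutomorphicRepData : Type _ :=
  {π : AutomorphicRepData (quasiSplitDatum F E c N hcpt) // π.W ≤ cuspForms F E c N hcpt}

/-! ## Unramified base change to `GL_N(E_w)` on Satake parameters -/

/-- The level `K_U(𝔫) = U(𝔸_F) ∩ K(𝔫)`, trace of the accepted principal congruence subgroup
`K(𝔫) ≤ GL_N(𝔸_E)` of level `𝔫 ⊴ 𝓞_E`; at a finite place `w ∤ 𝔫 · c(𝔫)` of `E` unramified over `F` its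
local factor is the hyperspecial subgroup `U(J_N)(𝒪_{F_v}) = U ∩ GL_N(𝒪_{E_w})` (`J_N` has unit
entries). Mok 2014, §4.3 (`K_v` hyperspecial for `v ∉ S`). [folklore] -/
def level (𝔫 : Ideal (𝓞 E)) : Subgroup (quasiSplit F E c N).Adelic :=
  (principalCongruenceLevel N E 𝔫).comap (adelicVal F E c N _)

/-- `t ∈ U(𝔸_F)` is **supported over the place `v` of `F` below `w`**: its archimedean component is `1`
and its components at the finite places `u ∉ {w, c w}` of `E` (i.e. not above `v`) are `1`. [folklore] -/
def IsSupportedAt (w : HeightOneSpectrum (𝓞 E)) (t : (quasiSplit F E c N).Adelic) : Prop :=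
  GLn.fstHom N E (adelicVal F E c N _ t) = 1 ∧
    ∀ u : HeightOneSpectrum (𝓞 E), u ≠ w → u ≠ c • w →
      Matrix.GeneralLinearGroup.map (AdelicGroupData.adeleEval E u) (adelicVal F E c N _ t) = 1

/-- `b ∈ U(𝔸_F)` is **upper triangular at `w`** (its `w`-component lies in the upper triangular Borel
subgroup of `GL_N(E_w)`, which meets `U(J_N)` in a Borel subgroup `B` of the quasi-split group: the
point of the anti-diagonal form). Mok 2014, §1 (standard `F`-splitting). [folklore] -/
def IsUpperTriangularAt (w : HeightOneSpectrum (𝓞 E)) (b : (quasiSplit F E c N).Adelic) : Prop :=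
  ∀ i j : Fin N, j < i → ((adelicVal F E c N _ b).val i j).2 w = 0

/-- The `w`-adic order `ord_w(b_ii) ∈ ℤ` of the `i`-th diagonal entry of the `w`-component of `b`
(`Valued.v x = exp (-ord_w x)`; junk value `0` at `x = 0`). [folklore] -/
def diagOrd (w : HeightOneSpectrum (𝓞 E)) (b : (quasiSplit F E c N).Adelic) (i : Fin N) : ℤ :=
  -WithZero.log (Valued.v (((adelicVal F E c N _ b).val i i).2 w))

/-- The index set of the **free torus coordinates at `w`**: all of `Fin N` if `w ≠ c w` (`v` split,
`U(F_v) ≅ GL_N(E_w)`, torus `(E_wˣ)^N`), the first half `{i | 2 i < N}` if `w = c w` (`v` inert, the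
diagonal torus `{diag(t) | c(t_i) t_{N+1-i} = 1}` of `U(J_N)(F_v)` has rank `⌊N/2⌋`; for odd `N` the
middle coordinate has `ord_w = 0`). Mínguez 2011, §2–§4. [folklore] -/
def torusIndices (w : HeightOneSpectrum (𝓞 E)) : Finset (Fin N) :=
  Finset.univ.filter fun i : Fin N => c • w ≠ w ∨ 2 * (i : ℕ) < N

/-- The value `(χ_β · δ_B^{1/2})(b)` on an upper triangular `b` of the unramified character of the Borel
with parameters `β` times the square root of its modulus character:
`∏_i β_i ^ {ord_w b_ii} · (√q_w) ^ {-(N-1-2i) ord_w b_ii}` over the free torus coordinates `i`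
(`0`-based). For `U(J_N)` at an inert place `δ_B` is the square root of the modulus character of the
Borel of `GL_N(E_w)` on the diagonal torus of `U` (the root spaces pair up under `c`), whence the same
exponent of `√q_w = q_v` as in the split case (`q_w = q_v`, usual `GL_N` normalisation, the tree's
`HasSatakeParameterAt`). Cartier 1979, §3.2–3.3 and (4.2); Mínguez 2011, §4. [cite: CartierCorvallis1979, §3.3 and (4.2)] -/
def iwasawaChar (w : HeightOneSpectrum (𝓞 E)) (β : Fin N → ℂ) (b : (quasiSplit F E c N).Adelic) : ℂ :=
  ∏ i ∈ torusIndices F E c N w,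
    β i ^ diagOrd F E c N w b i *
      ((Real.sqrt (w.residueCard : ℝ) : ℝ) : ℂ) ^ (-(((N : ℤ) - 1 - 2 * (i : ℕ)) * diagOrd F E c N w b i))

/-- The **Iwasawa value** of a coset `y ∈ U(𝔸_F) / K`: `(χ_β δ_B^{1/2})(b)` for a representative `b ∈ y`
which is supported over `v` and upper triangular at `w` (value `0` if there is none; independent of the
choice when `χ_β δ^{1/2}` is trivial on `B ∩ K`, e.g. `K` hyperspecial at `v`). Cartier 1979, (4.2). [folklore] -/
def iwasawaValue (w : HeightOneSpectrum (𝓞 E)) (β : Fin N → ℂ) (K : Subgroup (quasiSplit F E c N).Adelic)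
    (y : (quasiSplit F E c N).Adelic ⧸ K) : ℂ :=
  if h : ∃ b : (quasiSplit F E c N).Adelic, IsSupportedAt F E c N w b ∧ IsUpperTriangularAt F E c N w b ∧
      (b : (quasiSplit F E c N).Adelic ⧸ K) = y
  then iwasawaChar F E c N w β h.choose else 0

/-- The **unramified Hecke eigenvalue** `λ_β([K t K]) = ∑_{y ∈ K t K / K} (χ_β δ_B^{1/2})(b_y)`: the Satake
transform of the double coset `K t K` evaluated at the unramified character `χ_β`, i.e. the eigenvalue of
the Hecke operator `[K t K]` on the spherical vector of the unramified principal series `I(χ_β)`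
(Iwasawa decomposition `y = b_y K`). A finite sum for `K` compact open; `finsum` as in the accepted
`heckeOperator`. Cartier 1979, §IV (4.2) with §3.3; Mínguez 2011, §4. [cite: CartierCorvallis1979, §IV (4.2)] -/
def heckeEigenvalue (w : HeightOneSpectrum (𝓞 E)) (β : Fin N → ℂ)
    (K : Subgroup (quasiSplit F E c N).Adelic) (t : (quasiSplit F E c N).Adelic) : ℂ :=
  ∑ᶠ y ∈ MulAction.orbit K (t : (quasiSplit F E c N).Adelic ⧸ K), iwasawaValue F E c N w β K y

/-- The **base-change constraint on the torus parameters at `w`**: none if `w ≠ c w` (split `v`: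
`U(F_v) ≅ GL_N(E_w)` and the standard base change to `GL_N(E_w)` is the identity on parameters,
Mok 2014, §2.1, `ξ_1 : g ↦ (g, ᵗg⁻¹)` and the identification `E_v = E_w × E_{w̄}`); if `w = c w` (inert
`v`), `β_{N-1-i} = β_i⁻¹` and, for odd `N`, the middle parameter is `1`: the standard base change of
the unramified representation of `U(J_N)(F_v)` with torus parameters `(β_i)_{2i<N}` is the unramified
representation of `GL_N(E_w)` with Satake parameter `{β_i} ∪ {1 (N odd)} ∪ {β_i⁻¹}`
(Mínguez 2011, Thm. 4.1; Mok 2014, §2.1–2.2). [cite: Minguez2011, Thm. 4.1] -/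
def IsBaseChangeParam (w : HeightOneSpectrum (𝓞 E)) (β : Fin N → ℂ) : Prop :=
  (∀ i, β i ≠ 0) ∧ (c • w = w → ∀ i : Fin N, β i.rev = (β i)⁻¹ ∧ (i.rev = i → β i = 1))

/-- **`π` has unramified base-change Satake parameter `α` at the finite place `w` of `E`**
(`π = W / W'` an automorphic representation datum of `U_{E/F}(N)`): there are a level `𝔫 ⊴ 𝓞_E` prime
to `w` and `c w`, torus parameters `β` satisfying the base-change constraint at `w` with
`α = {β_0, …, β_{N-1}}`, and a form `φ ∈ W ∖ W'` fixed by `K_U(𝔫)` which is, modulo `W'`, an eigenvector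
of every Hecke operator `[K_U(𝔫) t K_U(𝔫)]`, `t ∈ U(𝔸_F)` supported over the place `v` of `F` below
`w`, with the unramified eigenvalues `λ_β([K t K])` — i.e. `π_v` is `K_v`-spherical with Satake
parameter `χ_β` and `α` is the Satake parameter at `w` of its standard base change to `GL_N(E_w)`
(w.r.t. `q_w`; at `c w ≠ w` the same definition yields `α⁻¹`, as it must). Meaningful for `v`
unramified in `E` (then `K_v` is hyperspecial). This is the unramified local datum entering "weak base
change" `c(Π) = ξ_1(c(π))` (Mok 2014, §2.3 and §4.3, Cor. 4.3.8; Mínguez 2011, Thm. 4.1). [cite: Mok2014, §4.3 Cor. 4.3.8] -/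
def HasBaseChangeSatakeAt (π : AutomorphicRepData (quasiSplitDatum F E c N hcpt))
    (w : HeightOneSpectrum (𝓞 E)) (α : Multiset ℂ) : Prop :=
  ∃ (𝔫 : Ideal (𝓞 E)) (β : Fin N → ℂ), 𝔫 ≠ 0 ∧ ¬ w.asIdeal ∣ 𝔫 ∧ ¬ (c • w).asIdeal ∣ 𝔫 ∧
    IsBaseChangeParam F E c N w β ∧ α = Finset.univ.val.map β ∧
    ∃ φ ∈ π.W, φ ∉ π.W' ∧
      (∀ u ∈ level F E c N 𝔫, rightTranslation (quasiSplit F E c N) u φ = φ) ∧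
      ∀ t : (quasiSplit F E c N).Adelic, IsSupportedAt F E c N w t →
        heckeOperator (rightTranslation (quasiSplit F E c N)) (level F E c N 𝔫) t φ -
          heckeEigenvalue F E c N w β (level F E c N 𝔫) t • φ ∈ π.W'

variable {F E c N hcpt} in
/-- A base-change Satake parameter is a multiset of `N` complex numbers. [folklore] -/
theorem HasBaseChangeSatakeAt.card_eq {π : AutomorphicRepData (quasiSplitDatum F E c N hcpt)}
    {w : HeightOneSpectrum (𝓞 E)} {α : Multiset ℂ} (h : HasBaseChangeSatakeAt F E c N hcpt π w α) :
    Multiset.card α = N := by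
  obtain ⟨-, β, -, -, -, -, rfl, -⟩ := h
  simp

/-- `π` is **unramified at `w`** (has some base-change Satake parameter there). [folklore] -/
def IsUnramifiedAt (π : AutomorphicRepData (quasiSplitDatum F E c N hcpt)) (w : HeightOneSpectrum (𝓞 E)) :
    Prop :=
  ∃ α : Multiset ℂ, HasBaseChangeSatakeAt F E c N hcpt π w α

/-- **`Π` is a weak base change of `π`** (`Π = W / W'` — `P` in code, `Π` being a Lean keyword — an
automorphic representation datum of `GL_N(𝔸_E)`,
`π` one of `U_{E/F}(N)(𝔸_F)`): at all but finitely many finite places `w` of `E`, the Satake parameters of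
`Π` at `w` (accepted `AutomorphicRepData.HasSatakeParamAt`) are exactly the base-change Satake parameters
of `π` at `w` — Mok's `c(Π) = ξ_1(c(π))` for the standard base change `L`-embedding `ξ_1`
(Mok 2014, §2.3, §4.3 "weak base change", Cor. 4.3.8). [cite: Mok2014, §4.3 Cor. 4.3.8] -/
def IsWeakBaseChange (P : AutomorphicRepData (AutomorphyDatum.gl N E hcpt))
    (π : AutomorphicRepData (quasiSplitDatum F E c N hcpt)) : Prop :=
  ∀ᶠ w : HeightOneSpectrum (𝓞 E) in Filter.cofinite, ∀ α : Multiset ℂ,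
    HasBaseChangeSatakeAt F E c N hcpt π w α ↔ P.HasSatakeParamAt w α

end UnitaryGroup

/-- **Automorphic representations of the quasi-split unitary group `U_{E/F}(N)(𝔸_F)`** (the wanted notion
`UnitaryGroupAutomorphicRep`): automorphic representation data `W' < W` (an irreducible
`(𝔲, K_∞) × U(𝔸_F^∞)`-stable subquotient of the space of automorphic forms, accepted
`AutomorphicRepData`) for the automorphy datum `UnitaryGroup.quasiSplitDatum` of Mok's group.
Borel–Jacquet 1979, 4.6; Mok 2014, §2.5. [cite: Mok2014, §2.5] -/
abbrev UnitaryGroupAutomorphicRep (F E : Type) [Field F] [NumberField F] [Field E] [NumberField E]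
    [Algebra F E] (c : E ≃ₐ[F] E) (N : ℕ) (hcpt : isCompact_glFiniteIntegralLevel N E) : Type _ :=
  open scoped Classical in
  AutomorphicRepData (UnitaryGroup.quasiSplitDatum F E c N hcpt)

/-! ## Archimedean component at a real place of `F` inert in `E`: Harish-Chandra parameters -/

namespace UnitaryGroup

-- Mathlib idiom (Mathlib/Algebra/Lie/OfAssociative.lean); needed to mention Lie subalgebras of matrix algebras
attribute [local instance 100] LieRing.ofAssociativeRing

open NumberField.mixedEmbedding NumberField.InfinitePlace
open scoped Classical ComplexConjugate

variable (F E : Type) [Field F] [Field E] [NumberField E] [Algebra F E] (c : E ≃ₐ[F] E) (N : ℕ)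

/-- At a complex place `w` of `E`, the coordinate map `ψ_w : ℂ →+* ℂ` through which `c ⊗ 1` acts from the
`w`-coordinate to the `c w`-coordinate of `E ⊗ ℝ` (`ι_{c w} ∘ c ∘ ι_w⁻¹`, `ι` Mathlib's
`ringEquivComplexOfIsComplex`). [folklore] -/
def conjCoord (w : {w : InfinitePlace E // IsComplex w}) : ℂ →+* ℂ :=
  (Completion.ringEquivComplexOfIsComplex (isComplex_smul_iff.mpr w.2 : IsComplex (c • w.1))).toRingHom.comp
    ((galInfiniteCompletionMap c (rfl : c • w.1 = c • w.1)).comp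
      (Completion.ringEquivComplexOfIsComplex w.2).symm.toRingHom)

omit [NumberField E] in
/-- `ψ_w` is continuous. [folklore] -/
theorem continuous_conjCoord (w : {w : InfinitePlace E // IsComplex w}) : Continuous (conjCoord F E c w) :=
  (Completion.isometryEquivComplexOfIsComplex (isComplex_smul_iff.mpr w.2 : IsComplex (c • w.1))).continuous.comp
    ((continuous_galInfiniteCompletionMap F c rfl).comp
      (Completion.isometryEquivComplexOfIsComplex w.2).symm.continuous)

omit [NumberField E] in
/-- `ψ_w` transports the embedding of `w` to that of `c w`: `ψ_w (σ_w x) = σ_{c w} (c x)` for `x ∈ E`. [folklore] -/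
theorem conjCoord_embedding (w : {w : InfinitePlace E // IsComplex w}) (x : E) :
    conjCoord F E c w (w.1.embedding x) = (c • w.1).embedding (c x) := by
  have h1 : (Completion.ringEquivComplexOfIsComplex w.2).symm (w.1.embedding x) = (x : w.1.Completion) := by
    rw [RingEquiv.symm_apply_eq, Completion.ringEquivComplexOfIsComplex_apply]
    exact (Completion.extensionEmbedding_coe w.1 _).symm
  simp only [conjCoord, RingHom.coe_comp, RingEquiv.toRingHom_eq_coe, RingHom.coe_coe, Function.comp_apply,
    h1, galInfiniteCompletionMap_coe, Completion.ringEquivComplexOfIsComplex_apply]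
  exact Completion.extensionEmbedding_coe _ _

omit [NumberField E] in
/-- The `c w`-coordinate of `(c ⊗ 1) x` is `ψ_w` of the `w`-coordinate of `x`. [folklore] -/
theorem conjMixed_snd_smul (x : mixedSpace E) (w : {w : InfinitePlace E // IsComplex w}) :
    (conjMixed F E c x).2 ⟨c • w.1, isComplex_smul_iff.mpr w.2⟩ = conjCoord F E c w (x.2 w) := by
  obtain ⟨y, rfl⟩ := (InfiniteAdeleRing.ringEquiv_mixedSpace E).surjective x
  rw [conjMixed_ringEquiv]
  simp only [InfiniteAdeleRing.ringEquiv_mixedSpace_apply, Completion.ringEquivComplexOfIsComplex_apply,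
    conjCoord, RingHom.coe_comp, RingEquiv.toRingHom_eq_coe, RingHom.coe_coe, Function.comp_apply]
  rw [InfiniteAdeleRing.smul_apply_smul F c y w.1]
  congr 1
  exact congrArg (galInfiniteCompletionMap c rfl)
    ((Completion.ringEquivComplexOfIsComplex _).symm_apply_apply _).symm

omit [NumberField E] in
/-- **At a complex place `w` fixed by `c ≠ 1`, `c ⊗ 1` acts on the `w`-coordinate as complex
conjugation**: `ψ_w` is a continuous ring endomorphism of `ℂ`, hence `id` or `conj`, and it is not the
identity since `c` moves some element of the dense subfield `E`. [folklore] -/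
theorem conjCoord_eq_conj {w : {w : InfinitePlace E // IsComplex w}} (hw : c • w.1 = w.1) (hc : c ≠ 1) :
    conjCoord F E c w = starRingEnd ℂ := by
  rcases Complex.ringHom_eq_id_or_conj_of_continuous (continuous_conjCoord F E c w) with h | h
  · exfalso
    apply hc
    ext x
    have hx := conjCoord_embedding F E c w x
    rw [h, RingHom.id_apply, congrArg InfinitePlace.embedding hw] at hx
    exact (w.1.embedding.injective hx).symm
  · exact h

omit [NumberField E] in
variable {F E c} in
/-- For `c w = w`: the `w`-coordinate of `(c ⊗ 1) x` is `ψ_w (x_w)`. [folklore] -/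
theorem conjMixed_snd_self {w : {w : InfinitePlace E // IsComplex w}} (hw : c • w.1 = w.1) (x : mixedSpace E) :
    (conjMixed F E c x).2 w = conjCoord F E c w (x.2 w) := by
  have h := conjMixed_snd_smul F E c x w
  have hsub : (⟨c • w.1, isComplex_smul_iff.mpr w.2⟩ : {w : InfinitePlace E // IsComplex w}) = w :=
    Subtype.ext hw
  rw [hsub] at h
  exact h

omit [NumberField E] in
variable {F E c} in
/-- For `c w = w`, `c ≠ 1`: **`c ⊗ 1` acts on the `w`-factor `𝔤𝔩_N(E_w) = 𝔤𝔩_N(ℂ) ⊆ 𝔤𝔩_N(E ⊗ ℝ)` by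
entrywise complex conjugation** (the accepted `complexPlaceLie` is the inclusion of the factor). [folklore] -/
theorem map_conjMixed_complexPlaceLie {w : {w : InfinitePlace E // IsComplex w}} (hw : c • w.1 = w.1)
    (hc : c ≠ 1) (M : Matrix (Fin N) (Fin N) ℂ) :
    (complexPlaceLie N w M).map (conjMixed F E c) = complexPlaceLie N w (M.map (starRingEnd ℂ)) := by
  ext i j : 2
  · -- real coordinates vanish on both sides
    funext w'
    simp only [Matrix.map_apply, complexPlaceLie_apply]
    rw [conjMixed_fst_apply]
    simp
  · funext w'
    simp only [Matrix.map_apply, complexPlaceLie_apply]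
    by_cases h : w' = w
    · subst h
      rw [conjMixed_snd_self hw, conjCoord_eq_conj F E c hw hc]
      simp
    · have h' : (⟨c⁻¹ • w'.1, isComplex_smul_iff.mpr w'.2⟩ : {w : InfinitePlace E // IsComplex w}) ≠ w := by
        intro hh
        apply h
        apply Subtype.ext
        have := congrArg (fun u : {w : InfinitePlace E // IsComplex w} => c • u.1) hh
        simpa [hw] using this
      rw [conjMixed_snd_apply]
      simp [Pi.single_eq_of_ne h, Pi.single_eq_of_ne h']

omit [NumberField E] in
/-- An integer form multiplies the `w`-factor inclusion on the left inside the factor: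
`J₀ · ι_w(M) = ι_w(J₀ · M)`. [folklore] -/
theorem over_mul_complexPlaceLie (S : StdForm N) (w : {w : InfinitePlace E // IsComplex w})
    (M : Matrix (Fin N) (Fin N) ℂ) :
    S.over (mixedSpace E) * complexPlaceLie N w M = complexPlaceLie N w (S.over ℂ * M) := by
  ext i j : 1
  refine Prod.ext ?_ (funext fun w' => ?_)
  · simp [Matrix.mul_apply, complexPlaceLie_apply, Prod.fst_sum, StdForm.over]
  · simp only [Matrix.mul_apply, complexPlaceLie_apply, Prod.snd_sum, Finset.sum_apply, StdForm.over,
      Matrix.map_apply, eq_intCast]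
    by_cases h : w' = w
    · subst h; simp
    · simp [Pi.single_eq_of_ne h]

omit [NumberField E] in
/-- `ι_w(M) · J₀ = ι_w(M · J₀)`. [folklore] -/
theorem complexPlaceLie_mul_over (S : StdForm N) (w : {w : InfinitePlace E // IsComplex w})
    (M : Matrix (Fin N) (Fin N) ℂ) :
    complexPlaceLie N w M * S.over (mixedSpace E) = complexPlaceLie N w (M * S.over ℂ) := by
  ext i j : 1
  refine Prod.ext ?_ (funext fun w' => ?_)
  · simp [Matrix.mul_apply, complexPlaceLie_apply, Prod.fst_sum, StdForm.over]
  · simp only [Matrix.mul_apply, complexPlaceLie_apply, Prod.snd_sum, Finset.sum_apply, StdForm.over,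
      Matrix.map_apply, eq_intCast]
    by_cases h : w' = w
    · subst h; simp
    · simp [Pi.single_eq_of_ne h]

omit [NumberField E] in
/-- The `w`-factor inclusion is injective. [folklore] -/
theorem complexPlaceLie_eq_zero_iff (w : {w : InfinitePlace E // IsComplex w}) (M : Matrix (Fin N) (Fin N) ℂ) :
    complexPlaceLie N w M = 0 ↔ M = 0 := by
  constructor
  · intro h
    ext i j
    have hij := congrFun (congrArg Prod.snd (congrFun (congrFun h i) j)) w
    simpa using hij
  · rintro rfl; exact map_zero _

omit [NumberField E] in
variable {F E c} in
/-- **Membership of the `w`-factor in `𝔲(J₀)`** (`c w = w`, `c ≠ 1`): `ι_w(M) ∈ 𝔲(J₀)(E ⊗ ℝ)` iff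
`(M̄)ᵀ J₀ + J₀ M = 0`, i.e. `M ∈ 𝔲(J₀)_w ≅ 𝔲(p, q)`, a real form of `𝔤𝔩_N(ℂ)`. Knapp 2002, I.§1. [folklore] -/
theorem complexPlaceLie_mem_archLie_iff (S : StdForm N) {w : {w : InfinitePlace E // IsComplex w}}
    (hw : c • w.1 = w.1) (hc : c ≠ 1) (M : Matrix (Fin N) (Fin N) ℂ) :
    complexPlaceLie N w M ∈ archLie F E c N S ↔ (M.map (starRingEnd ℂ))ᵀ * S.over ℂ + S.over ℂ * M = 0 := by
  rw [mem_archLie_iff, map_conjMixed_complexPlaceLie N hw hc, archForm]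
  rw [show (complexPlaceLie N w (M.map (starRingEnd ℂ)))ᵀ = complexPlaceLie N w (M.map (starRingEnd ℂ))ᵀ from by
    ext i j : 1; simp [complexPlaceLie_apply]]
  rw [complexPlaceLie_mul_over, over_mul_complexPlaceLie, ← map_add, complexPlaceLie_eq_zero_iff]

/-- The "real part" `A(Z) = Z - J₀ Zᵀ J₀ ∈ 𝔲(J₀)_w` of a real matrix `Z` w.r.t. the decomposition
`𝔤𝔩_N(ℂ) = 𝔲 ⊕ i 𝔲` (`𝔲 = 𝔲(J₀)_w` the fixed points of `θ(M) = -J₀ M̄ᵀ J₀`): `Z = ½ (A(Z) + i B(Z))`. [folklore] -/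
def archRealPart (S : StdForm N) (Z : Matrix (Fin N) (Fin N) ℝ) : Matrix (Fin N) (Fin N) ℂ :=
  Z.map (algebraMap ℝ ℂ) - S.over ℂ * (Z.map (algebraMap ℝ ℂ))ᵀ * S.over ℂ

/-- The "imaginary part" `B(Z) = -i (Z + J₀ Zᵀ J₀) ∈ 𝔲(J₀)_w` of a real matrix `Z`. [folklore] -/
def archImagPart (S : StdForm N) (Z : Matrix (Fin N) (Fin N) ℝ) : Matrix (Fin N) (Fin N) ℂ :=
  (-Complex.I) • (Z.map (algebraMap ℝ ℂ) + S.over ℂ * (Z.map (algebraMap ℝ ℂ))ᵀ * S.over ℂ)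

omit [NumberField E] in
/-- `Z = ½ (A(Z) + i B(Z))`. [folklore] -/
theorem archRealPart_add_I_smul_archImagPart (S : StdForm N) (Z : Matrix (Fin N) (Fin N) ℝ) :
    archRealPart N S Z + Complex.I • archImagPart N S Z = (2 : ℂ) • Z.map (algebraMap ℝ ℂ) := by
  simp only [archRealPart, archImagPart, smul_smul, Complex.I_mul_I, mul_neg, neg_neg, one_smul, two_smul]
  abel

omit [NumberField E] in
variable {F E c} in
/-- `ι_w(A(Z)) ∈ 𝔲(J₀)(E ⊗ ℝ)`. [folklore] -/
theorem complexPlaceLie_archRealPart_mem (S : StdForm N) {w : {w : InfinitePlace E // IsComplex w}}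
    (hw : c • w.1 = w.1) (hc : c ≠ 1) (Z : Matrix (Fin N) (Fin N) ℝ) :
    complexPlaceLie N w (archRealPart N S Z) ∈ archLie F E c N S := by
  rw [complexPlaceLie_mem_archLie_iff N S hw hc, archRealPart]
  set Jc := S.over ℂ with hJc
  set Zc := Z.map (algebraMap ℝ ℂ) with hZc
  have hJJ : Jc * Jc = 1 := S.over_mul_over ℂ
  have hJt : Jcᵀ = Jc := S.transpose_over ℂ
  have hJm : Jc.map (starRingEnd ℂ) = Jc := S.over_map _
  have hZ : Zc.map (starRingEnd ℂ) = Zc := by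
    rw [hZc, Matrix.map_map]; congr 1; funext x; simp
  rw [Matrix.map_sub _ (map_sub _), Matrix.map_mul, Matrix.map_mul, Matrix.transpose_map, hZ, hJm,
    Matrix.transpose_sub, Matrix.transpose_mul, Matrix.transpose_mul, Matrix.transpose_transpose, hJt]
  calc (Zcᵀ - Jc * (Zc * Jc)) * Jc + Jc * (Zc - Jc * Zcᵀ * Jc)
      = Zcᵀ * Jc - Jc * Zc * (Jc * Jc) + Jc * Zc - (Jc * Jc) * Zcᵀ * Jc := by noncomm_ring
    _ = 0 := by rw [hJJ]; noncomm_ring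

omit [NumberField E] in
variable {F E c} in
/-- `ι_w(B(Z)) ∈ 𝔲(J₀)(E ⊗ ℝ)` (this is where `c` must act as conjugation). [folklore] -/
theorem complexPlaceLie_archImagPart_mem (S : StdForm N) {w : {w : InfinitePlace E // IsComplex w}}
    (hw : c • w.1 = w.1) (hc : c ≠ 1) (Z : Matrix (Fin N) (Fin N) ℝ) :
    complexPlaceLie N w (archImagPart N S Z) ∈ archLie F E c N S := by
  rw [complexPlaceLie_mem_archLie_iff N S hw hc, archImagPart]
  set Jc := S.over ℂ with hJc
  set Zc := Z.map (algebraMap ℝ ℂ) with hZc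
  have hJJ : Jc * Jc = 1 := S.over_mul_over ℂ
  have hJt : Jcᵀ = Jc := S.transpose_over ℂ
  have hJm : Jc.map (starRingEnd ℂ) = Jc := S.over_map _
  have hZ : Zc.map (starRingEnd ℂ) = Zc := by
    rw [hZc, Matrix.map_map]; congr 1; funext x; simp
  set U := Zc + Jc * Zcᵀ * Jc with hU
  have hUm : U.map (starRingEnd ℂ) = U := by
    rw [hU, Matrix.map_add _ (map_add _), Matrix.map_mul, Matrix.map_mul, Matrix.transpose_map, hZ, hJm]
  have hM : ((-Complex.I) • U).map (starRingEnd ℂ) = Complex.I • U := by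
    conv_rhs => rw [← hUm]
    ext i j
    simp [Matrix.map_apply]
  have hUt : Uᵀ * Jc - Jc * U = 0 := by
    rw [hU, Matrix.transpose_add, Matrix.transpose_mul, Matrix.transpose_mul, Matrix.transpose_transpose, hJt]
    calc (Zcᵀ + Jc * (Zc * Jc)) * Jc - Jc * (Zc + Jc * Zcᵀ * Jc)
        = Zcᵀ * Jc + Jc * Zc * (Jc * Jc) - Jc * Zc - (Jc * Jc) * Zcᵀ * Jc := by noncomm_ring
      _ = 0 := by rw [hJJ]; noncomm_ring
  rw [hM, Matrix.transpose_smul, Matrix.smul_mul, Matrix.mul_smul, neg_smul, ← sub_eq_add_neg, ← smul_sub,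
    hUt, smul_zero]

omit [NumberField E] in
/-- `A` is additive. [folklore] -/
theorem archRealPart_add (S : StdForm N) (Z₁ Z₂ : Matrix (Fin N) (Fin N) ℝ) :
    archRealPart N S (Z₁ + Z₂) = archRealPart N S Z₁ + archRealPart N S Z₂ := by
  simp only [archRealPart, Matrix.map_add _ (map_add _), Matrix.transpose_add, Matrix.mul_add, Matrix.add_mul]
  abel

omit [NumberField E] in
/-- `B` is additive. [folklore] -/
theorem archImagPart_add (S : StdForm N) (Z₁ Z₂ : Matrix (Fin N) (Fin N) ℝ) :
    archImagPart N S (Z₁ + Z₂) = archImagPart N S Z₁ + archImagPart N S Z₂ := by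
  simp only [archImagPart, Matrix.map_add _ (map_add _), Matrix.transpose_add, Matrix.mul_add, Matrix.add_mul,
    ← smul_add]
  congr 1
  abel

omit [NumberField E] in
/-- `A` is `ℝ`-homogeneous. [folklore] -/
theorem archRealPart_smul (S : StdForm N) (t : ℝ) (Z : Matrix (Fin N) (Fin N) ℝ) :
    archRealPart N S (t • Z) = (t : ℂ) • archRealPart N S Z := by
  have h : (t • Z).map (algebraMap ℝ ℂ) = (t : ℂ) • Z.map (algebraMap ℝ ℂ) := by
    ext i j; simp
  simp only [archRealPart, h, Matrix.transpose_smul, Matrix.smul_mul, Matrix.mul_smul, smul_sub]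

omit [NumberField E] in
/-- `B` is `ℝ`-homogeneous. [folklore] -/
theorem archImagPart_smul (S : StdForm N) (t : ℝ) (Z : Matrix (Fin N) (Fin N) ℝ) :
    archImagPart N S (t • Z) = (t : ℂ) • archImagPart N S Z := by
  have h : (t • Z).map (algebraMap ℝ ℂ) = (t : ℂ) • Z.map (algebraMap ℝ ℂ) := by
    ext i j; simp
  simp only [archImagPart, h, Matrix.transpose_smul, Matrix.smul_mul, Matrix.mul_smul, ← smul_add, smul_smul,
    mul_comm]

omit [NumberField E] in
/-- **Bracket relations of the decomposition `𝔤𝔩_N(ℂ) = 𝔲 ⊕ i𝔲` on real matrices, real part**: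
`2 A([Z₁, Z₂]) = [A Z₁, A Z₂] - [B Z₁, B Z₂]`. [folklore] -/
theorem two_smul_archRealPart_lie (S : StdForm N) (Z₁ Z₂ : Matrix (Fin N) (Fin N) ℝ) :
    (2 : ℂ) • archRealPart N S ⁅Z₁, Z₂⁆ =
      ⁅archRealPart N S Z₁, archRealPart N S Z₂⁆ - ⁅archImagPart N S Z₁, archImagPart N S Z₂⁆ := by
  simp only [archRealPart, archImagPart, Ring.lie_def, Matrix.map_sub _ (map_sub _), Matrix.map_mul]
  set Jc := S.over ℂ
  set X₁ := Z₁.map (algebraMap ℝ ℂ)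
  set X₂ := Z₂.map (algebraMap ℝ ℂ)
  have hJJ : Jc * Jc = 1 := S.over_mul_over ℂ
  set W₁ := Jc * X₁ᵀ * Jc with hW₁
  set W₂ := Jc * X₂ᵀ * Jc with hW₂
  have hW12 : W₁ * W₂ = Jc * X₁ᵀ * X₂ᵀ * Jc := by
    calc W₁ * W₂ = Jc * X₁ᵀ * (Jc * Jc) * X₂ᵀ * Jc := by rw [hW₁, hW₂]; noncomm_ring
      _ = _ := by rw [hJJ]; noncomm_ring
  have hW21 : W₂ * W₁ = Jc * X₂ᵀ * X₁ᵀ * Jc := by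
    calc W₂ * W₁ = Jc * X₂ᵀ * (Jc * Jc) * X₁ᵀ * Jc := by rw [hW₁, hW₂]; noncomm_ring
      _ = _ := by rw [hJJ]; noncomm_ring
  have hT : Jc * (X₁ * X₂ - X₂ * X₁)ᵀ * Jc = W₂ * W₁ - W₁ * W₂ := by
    rw [Matrix.transpose_sub, Matrix.transpose_mul, Matrix.transpose_mul, hW12, hW21]; noncomm_ring
  have hI : (-Complex.I) • (X₁ + W₁) * ((-Complex.I) • (X₂ + W₂)) = -((X₁ + W₁) * (X₂ + W₂)) := by
    rw [Matrix.smul_mul, Matrix.mul_smul, smul_smul, neg_mul_neg, Complex.I_mul_I, neg_one_smul]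
  have hI' : (-Complex.I) • (X₂ + W₂) * ((-Complex.I) • (X₁ + W₁)) = -((X₂ + W₂) * (X₁ + W₁)) := by
    rw [Matrix.smul_mul, Matrix.mul_smul, smul_smul, neg_mul_neg, Complex.I_mul_I, neg_one_smul]
  rw [hT, hI, hI', two_smul]
  noncomm_ring

omit [NumberField E] in
/-- **Bracket relations, imaginary part**: `2 B([Z₁, Z₂]) = [A Z₁, B Z₂] + [B Z₁, A Z₂]`. [folklore] -/
theorem two_smul_archImagPart_lie (S : StdForm N) (Z₁ Z₂ : Matrix (Fin N) (Fin N) ℝ) :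
    (2 : ℂ) • archImagPart N S ⁅Z₁, Z₂⁆ =
      ⁅archRealPart N S Z₁, archImagPart N S Z₂⁆ + ⁅archImagPart N S Z₁, archRealPart N S Z₂⁆ := by
  simp only [archRealPart, archImagPart, Ring.lie_def, Matrix.map_sub _ (map_sub _), Matrix.map_mul]
  set Jc := S.over ℂ
  set X₁ := Z₁.map (algebraMap ℝ ℂ)
  set X₂ := Z₂.map (algebraMap ℝ ℂ)
  have hJJ : Jc * Jc = 1 := S.over_mul_over ℂ
  set W₁ := Jc * X₁ᵀ * Jc with hW₁
  set W₂ := Jc * X₂ᵀ * Jc with hW₂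
  have hW12 : W₁ * W₂ = Jc * X₁ᵀ * X₂ᵀ * Jc := by
    calc W₁ * W₂ = Jc * X₁ᵀ * (Jc * Jc) * X₂ᵀ * Jc := by rw [hW₁, hW₂]; noncomm_ring
      _ = _ := by rw [hJJ]; noncomm_ring
  have hW21 : W₂ * W₁ = Jc * X₂ᵀ * X₁ᵀ * Jc := by
    calc W₂ * W₁ = Jc * X₂ᵀ * (Jc * Jc) * X₁ᵀ * Jc := by rw [hW₁, hW₂]; noncomm_ring
      _ = _ := by rw [hJJ]; noncomm_ring
  have hT : Jc * (X₁ * X₂ - X₂ * X₁)ᵀ * Jc = W₂ * W₁ - W₁ * W₂ := by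
    rw [Matrix.transpose_sub, Matrix.transpose_mul, Matrix.transpose_mul, hW12, hW21]; noncomm_ring
  rw [hT, smul_comm (2 : ℂ) (-Complex.I), Matrix.mul_smul, Matrix.smul_mul, Matrix.mul_smul, Matrix.smul_mul,
    ← smul_sub, ← smul_sub, ← smul_add]
  congr 1
  rw [two_smul]
  noncomm_ring

variable {F E c} in
/-- The element `ι_w(A(Z)) ∈ 𝔲(J₀)(E ⊗ ℝ)`. [folklore] -/
def archRealEl (S : StdForm N) {w : {w : InfinitePlace E // IsComplex w}} (hw : c • w.1 = w.1) (hc : c ≠ 1)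
    (Z : Matrix (Fin N) (Fin N) ℝ) : archLie F E c N S :=
  ⟨_, complexPlaceLie_archRealPart_mem N S hw hc Z⟩

variable {F E c} in
/-- The element `ι_w(B(Z)) ∈ 𝔲(J₀)(E ⊗ ℝ)`. [folklore] -/
def archImagEl (S : StdForm N) {w : {w : InfinitePlace E // IsComplex w}} (hw : c • w.1 = w.1) (hc : c ≠ 1)
    (Z : Matrix (Fin N) (Fin N) ℝ) : archLie F E c N S :=
  ⟨_, complexPlaceLie_archImagPart_mem N S hw hc Z⟩

omit [NumberField E] in
/-- Real scalars act on complex matrices through `ℝ → ℂ`. [folklore] -/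
theorem real_smul_eq_coe_smul_matrix (t : ℝ) (M : Matrix (Fin N) (Fin N) ℂ) : t • M = (t : ℂ) • M := by
  ext i j; simp

omit [NumberField E] in
variable {F E c} in
/-- In `𝔲`: `2 ι_w(A [Z₁,Z₂]) = [ι_w A₁, ι_w A₂] - [ι_w B₁, ι_w B₂]`. [folklore] -/
theorem two_smul_archRealEl_lie (S : StdForm N) {w : {w : InfinitePlace E // IsComplex w}} (hw : c • w.1 = w.1)
    (hc : c ≠ 1) (Z₁ Z₂ : Matrix (Fin N) (Fin N) ℝ) :
    (2 : ℝ) • archRealEl N S hw hc ⁅Z₁, Z₂⁆ =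
      ⁅archRealEl N S hw hc Z₁, archRealEl N S hw hc Z₂⁆ - ⁅archImagEl N S hw hc Z₁, archImagEl N S hw hc Z₂⁆ := by
  apply Subtype.ext
  change (2 : ℝ) • complexPlaceLie N w (archRealPart N S ⁅Z₁, Z₂⁆) =
    ⁅complexPlaceLie N w (archRealPart N S Z₁), complexPlaceLie N w (archRealPart N S Z₂)⁆ -
      ⁅complexPlaceLie N w (archImagPart N S Z₁), complexPlaceLie N w (archImagPart N S Z₂)⁆
  rw [← LieHom.map_lie, ← LieHom.map_lie, ← map_sub, ← two_smul_archRealPart_lie, ← map_smul (complexPlaceLie N w),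
    real_smul_eq_coe_smul_matrix, Complex.ofReal_ofNat]

omit [NumberField E] in
variable {F E c} in
/-- In `𝔲`: `2 ι_w(B [Z₁,Z₂]) = [ι_w A₁, ι_w B₂] + [ι_w B₁, ι_w A₂]`. [folklore] -/
theorem two_smul_archImagEl_lie (S : StdForm N) {w : {w : InfinitePlace E // IsComplex w}} (hw : c • w.1 = w.1)
    (hc : c ≠ 1) (Z₁ Z₂ : Matrix (Fin N) (Fin N) ℝ) :
    (2 : ℝ) • archImagEl N S hw hc ⁅Z₁, Z₂⁆ =
      ⁅archRealEl N S hw hc Z₁, archImagEl N S hw hc Z₂⁆ + ⁅archImagEl N S hw hc Z₁, archRealEl N S hw hc Z₂⁆ := by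
  apply Subtype.ext
  change (2 : ℝ) • complexPlaceLie N w (archImagPart N S ⁅Z₁, Z₂⁆) =
    ⁅complexPlaceLie N w (archRealPart N S Z₁), complexPlaceLie N w (archImagPart N S Z₂)⁆ +
      ⁅complexPlaceLie N w (archImagPart N S Z₁), complexPlaceLie N w (archRealPart N S Z₂)⁆
  rw [← LieHom.map_lie, ← LieHom.map_lie, ← map_add, ← two_smul_archImagPart_lie, ← map_smul (complexPlaceLie N w),
    real_smul_eq_coe_smul_matrix, Complex.ofReal_ofNat]

/-- The complexification identity in a complex Lie algebra: with `u = ½`,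
`[u(a₁ + i b₁), u(a₂ + i b₂)] = u (u([a₁,a₂] - [b₁,b₂]) + i u([a₁,b₂] + [b₁,a₂]))`. [folklore] -/
theorem lie_complexify_aux {L : Type*} [LieRing L] [LieAlgebra ℂ L] (a₁ b₁ a₂ b₂ : L) :
    ⁅(2 : ℂ)⁻¹ • (a₁ + Complex.I • b₁), (2 : ℂ)⁻¹ • (a₂ + Complex.I • b₂)⁆ =
      (2 : ℂ)⁻¹ • ((2 : ℂ)⁻¹ • (⁅a₁, a₂⁆ - ⁅b₁, b₂⁆) + Complex.I • ((2 : ℂ)⁻¹ • (⁅a₁, b₂⁆ + ⁅b₁, a₂⁆))) := by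
  have h : (Complex.I * Complex.I) • ⁅b₁, b₂⁆ = (-1 : ℂ) • ⁅b₁, b₂⁆ := by rw [Complex.I_mul_I]
  simp only [smul_lie, lie_smul, lie_add, add_lie, smul_add, smul_sub, smul_smul]
  linear_combination (norm := module) ((2 : ℂ)⁻¹ * (2 : ℂ)⁻¹) • h

variable {V : Type*} [AddCommGroup V] [Module ℂ V]

omit [NumberField E] in
/-- Real scalars act on `End_ℂ(V)` through `ℝ → ℂ`. [folklore] -/
theorem real_smul_eq_coe_smul_end (t : ℝ) (f : Module.End ℂ V) : t • f = (t : ℂ) • f := by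
  ext v
  simp [LinearMap.smul_apply, Complex.coe_smul]

variable {F E c} in
/-- **The complexified action at `w` restricted to `𝔤𝔩_N(ℝ)`** (see `IsComplexifiedActionAt`):
`Z ↦ ½ (ρ𝔤(ι_w A(Z)) + i ρ𝔤(ι_w B(Z)))`, a homomorphism of real Lie algebras `𝔤𝔩_N(ℝ) → End_ℂ(V)`
(proved: the bracket relations `two_smul_archRealEl_lie`, `two_smul_archImagEl_lie`). Knapp 2002, VI.§2
(complexification of a real form). [folklore] -/
def complexifyAt (S : StdForm N) {w : {w : InfinitePlace E // IsComplex w}} (hw : c • w.1 = w.1) (hc : c ≠ 1)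
    (ρ𝔤 : archLie F E c N S →ₗ⁅ℝ⁆ Module.End ℂ V) : Matrix (Fin N) (Fin N) ℝ →ₗ⁅ℝ⁆ Module.End ℂ V where
  toFun Z := (2 : ℂ)⁻¹ • (ρ𝔤 (archRealEl N S hw hc Z) + Complex.I • ρ𝔤 (archImagEl N S hw hc Z))
  map_add' Z₁ Z₂ := by
    have hA : archRealEl N S hw hc (Z₁ + Z₂) = archRealEl N S hw hc Z₁ + archRealEl N S hw hc Z₂ :=
      Subtype.ext (by
        change complexPlaceLie N w (archRealPart N S (Z₁ + Z₂)) =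
          complexPlaceLie N w (archRealPart N S Z₁) + complexPlaceLie N w (archRealPart N S Z₂)
        rw [archRealPart_add, map_add])
    have hB : archImagEl N S hw hc (Z₁ + Z₂) = archImagEl N S hw hc Z₁ + archImagEl N S hw hc Z₂ :=
      Subtype.ext (by
        change complexPlaceLie N w (archImagPart N S (Z₁ + Z₂)) =
          complexPlaceLie N w (archImagPart N S Z₁) + complexPlaceLie N w (archImagPart N S Z₂)
        rw [archImagPart_add, map_add])
    simp only [hA, hB, map_add, smul_add]
    abel
  map_smul' t Z := by
    have hA : archRealEl N S hw hc (t • Z) = t • archRealEl N S hw hc Z :=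
      Subtype.ext (by
        change complexPlaceLie N w (archRealPart N S (t • Z)) = t • complexPlaceLie N w (archRealPart N S Z)
        rw [archRealPart_smul, ← real_smul_eq_coe_smul_matrix, map_smul])
    have hB : archImagEl N S hw hc (t • Z) = t • archImagEl N S hw hc Z :=
      Subtype.ext (by
        change complexPlaceLie N w (archImagPart N S (t • Z)) = t • complexPlaceLie N w (archImagPart N S Z)
        rw [archImagPart_smul, ← real_smul_eq_coe_smul_matrix, map_smul])
    simp only [hA, hB, map_smul, RingHom.id_apply, real_smul_eq_coe_smul_end, smul_add, smul_smul]
    module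
  map_lie' {Z₁ Z₂} := by
    have hA := congrArg ρ𝔤 (two_smul_archRealEl_lie N S hw hc Z₁ Z₂)
    have hB := congrArg ρ𝔤 (two_smul_archImagEl_lie N S hw hc Z₁ Z₂)
    rw [map_smul, map_sub, LieHom.map_lie, LieHom.map_lie, real_smul_eq_coe_smul_end, Complex.ofReal_ofNat] at hA
    rw [map_smul, map_add, LieHom.map_lie, LieHom.map_lie, real_smul_eq_coe_smul_end, Complex.ofReal_ofNat] at hB
    have h2 : (2 : ℂ) ≠ 0 := two_ne_zero
    have hA' : ρ𝔤 (archRealEl N S hw hc ⁅Z₁, Z₂⁆) = (2 : ℂ)⁻¹ •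
        (⁅ρ𝔤 (archRealEl N S hw hc Z₁), ρ𝔤 (archRealEl N S hw hc Z₂)⁆ -
          ⁅ρ𝔤 (archImagEl N S hw hc Z₁), ρ𝔤 (archImagEl N S hw hc Z₂)⁆) := by
      rw [← hA, smul_smul, inv_mul_cancel₀ h2, one_smul]
    have hB' : ρ𝔤 (archImagEl N S hw hc ⁅Z₁, Z₂⁆) = (2 : ℂ)⁻¹ •
        (⁅ρ𝔤 (archRealEl N S hw hc Z₁), ρ𝔤 (archImagEl N S hw hc Z₂)⁆ +
          ⁅ρ𝔤 (archImagEl N S hw hc Z₁), ρ𝔤 (archRealEl N S hw hc Z₂)⁆) := by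
      rw [← hB, smul_smul, inv_mul_cancel₀ h2, one_smul]
    simp only [hA', hB']
    exact (lie_complexify_aux _ _ _ _).symm

omit [NumberField E] in
variable {F E c} in
/-- Unfolding `complexifyAt`. [folklore] -/
theorem complexifyAt_apply (S : StdForm N) {w : {w : InfinitePlace E // IsComplex w}} (hw : c • w.1 = w.1)
    (hc : c ≠ 1) (ρ𝔤 : archLie F E c N S →ₗ⁅ℝ⁆ Module.End ℂ V) (Z : Matrix (Fin N) (Fin N) ℝ) :
    complexifyAt N S hw hc ρ𝔤 Z =
      (2 : ℂ)⁻¹ • (ρ𝔤 (archRealEl N S hw hc Z) + Complex.I • ρ𝔤 (archImagEl N S hw hc Z)) := rfl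

/-- **`π` has Harish-Chandra parameter `Λ` at the complex place `w` of `E` fixed by `c`** (i.e. at the
real place `v = w|_F` of `F`, where `U(J₀)(F_v) ≅ U(p, q)` is a real form of `GL_N(ℂ)`; requires
`c ≠ 1`): the Lie algebra action `ρ𝔤` of `π` on `W / W'` (accepted `HasLieAction`; it is unique) has,
after complexification at `w` and restriction to `𝔤𝔩_N(ℝ)` (`complexifyAt`), Harish-Chandra parameter
`Λ` in the sense of the accepted `HasHCParameter` for `𝔤𝔩_N(ℝ)` — a multiset of `N` complex numbers,
the infinitesimal character of `π_v` under `Z(𝔲(p,q)_ℂ) = Z(𝔤𝔩_N(ℂ)) ≅ ℂ[x_1, …, x_N]^{𝔖_N}`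
(e.g. a discrete series or limit of discrete series of `U(p, q)` with Harish-Chandra parameter
`(a_1, …, a_N)` has `Λ = {a_i}`). This is the archimedean datum consumed by statements about (limits
of) discrete series (wanted notion `IsNondegenerateLimitOfDiscreteSeries`) and by the infinity type of
the base change to `GL_N(𝔸_E)`. Borel–Jacquet 1979, 4.6; Knapp 2002, Thm. 5.44 and VI.§2;
Clozel 1990, §3.3. [folklore] -/
def HasHCParameterAt [NumberField F] (S : StdForm N) (hcpt : isCompact_glFiniteIntegralLevel N E)
    (π : AutomorphicRepData (automorphyDatum F E c N S hcpt))
    {w : {w : InfinitePlace E // IsComplex w}} (hw : c • w.1 = w.1) (hc : c ≠ 1) (Λ : Multiset ℂ) : Prop :=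
  ∃ ρ𝔤 : (automorphyDatum F E c N S hcpt).arch.lie →ₗ⁅ℝ⁆ Module.End ℂ π.Quot, π.HasLieAction ρ𝔤 ∧
    HasHCParameter (𝕜 := ℝ) (complexifyAt N S hw hc ρ𝔤) fun _ => Λ

variable {F E c N} in
/-- A Harish-Chandra parameter at `w` has `N` entries. [folklore] -/
theorem HasHCParameterAt.card_eq [NumberField F] {S : StdForm N} {hcpt : isCompact_glFiniteIntegralLevel N E}
    {π : AutomorphicRepData (automorphyDatum F E c N S hcpt)} {w : {w : InfinitePlace E // IsComplex w}}
    {hw : c • w.1 = w.1} {hc : c ≠ 1} {Λ : Multiset ℂ} (h : HasHCParameterAt F E c N S hcpt π hw hc Λ) :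
    Multiset.card Λ = N := by
  obtain ⟨ρ𝔤, -, hρ⟩ := h
  exact card_eq_of_hasHCParameter _ hρ (Algebra.ofId ℝ ℂ)

end UnitaryGroup

end Literature.NumberTheory.Automorphic
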